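/-
Copyright: lit-balaban READER/TYPER seat r18 (gen 30).  Statement-level skeleton of a published paper; no proof claims beyond what the kernel
checks below.
-/
import Literature.MathematicalPhysics.QuantumFieldTheory.BalabanImbrieJaffe1984to88.BIJ88HkLocHolderTorus
import Literature.MathematicalPhysics.QuantumFieldTheory.BalabanImbrieJaffe1984to88.BIJ88CurlyDkLocGradTerm

/-!
# `BalabanImbrieJaffe1984to88.BIJ88CurlyDkLocHolderTorus` — T. Bałaban, J. Imbrie, A. Jaffe, *Effective action and cluster properties of the
abelian Higgs model*, Commun. Math. Phys. **114** (1988) 257–315 [BalabanImbrieJaffe1988], Sect. 2 p. 261 [PDF 5]: **THE HÖLDER CLAUSE OF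
(2.13) — *"and similarly for derivatives of 𝒟_{k,loc} and Hölder derivatives of order less than 2"* — FOR THE (2.12) PROPAGATOR LOCALIZED WITH
PRINT'S SMOOTH-IN-`b` CUTOFF ON THE TORI OF THE SERIES**, together with the value and derivative members and the finite range of the same object,
HYPOTHESIS-FREE and with ONE set of constants for every torus, every step `k` and every admissible radius schedule.

statement-level skeleton of published theorems with citation tags; proofs where landed; nothing here is a claim about the Yang–Mills mass gap

PDF held: `paper:balaban1988-cmp114-bij-abelian-higgs-effective-action` (journal page = PDF page + 256), p. 260–261 [PDF 4–5] (text layer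
`~/.lit/texts/paper-balaban1988-cmp114-bij-abelian-higgs-effective-action/p0005.txt` materialised and re-read this session 2026-08-23); [I] =
[BalabanImbrieJaffe1985] p. 312 (4.4.4), p. 325–326 (7.2.2)–(7.2.4).

CITATION HEADER (lean-in-tree rule).  Part of the lit-balaban TYPED SKELETON (HOME `run/shared/lean/pub/lit-balaban/`), READER/TYPER seat r18 =
the C2 §§1–4 fold owner (unit `lit-balaban-r18`, literature-prover-lit-balaban-r18-g30-0); own lane = `C2S14-CLOSURE.md` §3 item 5 / §5 item 1
*"remaining = (2.12)/(2.13) with the forked 𝒟^Π_{k,loc}"*; TAKING line HOME/STATUS.md 2026-08-23T22:50Z.  Rows of `HOME/lit-balaban-r18/ROWS-C2.md`: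
**C2.Eq2.13** (owner r18, referee ref-5; head = p08's hence-steps, `proved`, UNCHANGED — located member, cells only) and the DEF row **C2.Eq2.12**
(cells only).  r16's cell C2.Eq5.4.7 records the state of the art for the object of record: *"the p.261 sentence is kernel-complete for the concrete
𝒟_{k,loc} in value AND first-difference form (decay (2.13), finite range, closeness), Hölder clause excepted (ruled out for the typed sup-norm cutoff,
p08 gen 8)"* — this file supplies the excepted clause for the print-faithful smooth cutoff.  Decls used BY NAME (nothing restated, nothing re-proved):
r18 g21 `BIJ88HkLocHolderTorus.hlKerPi`/`zetaPi`/`zetaPiB`/`isCutoff_zetaPiB`/`abs_zetaPi_le_one`/`hlKerPi_apply`/`hlKerPi_eq_H`/`holderConst`/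
`holder25_zetaPi_of_bounds`/`deriv25_zetaPi_of_bounds`/`exists_holderBounds_allTori`/`printedRadii_admissible`; r18 g10 `BIJ88CurlyDkLocTorus.clKer`/
`hKer`/`hdist`/`kdist`/`bdist_le_of_clKer_ne_zero`; p08 `BIJ88CurlyDkLocDecayTorus.abs_triple_le`/`abs_clKer_ambient_le`/`abs_sum_scales_le`,
`BIJ88CurlyDkLocGradTerm.abs_triple_le₂`, `BIJ88Decay216Torus.triple_sum_le`; p09 g8 `BIJ88ClocEstimatesTorus.cloc_decay`; p09's `distEU`/`ctr`/
`supDist_ctr_ctr`/`supDist_triangle`; the tree's `Literature.Analysis.Calculus.LogCutoff.exists_abs_deriv_and_deriv_deriv_smoothTransition_le`.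
ARCHITECTURE CREDIT: p08 gens 8–9 (`BIJ85CurlyDkHolder{Term,Sum,Torus}` for the unlocalized `𝒟_k`, `BIJ88CurlyDkLoc{Decay,GradTerm,Grad}Torus` for
the value/derivative members of the `𝒟_{k,loc}` of record) — the proofs below repeat that architecture with the smooth cutoff inserted.

THE PRINTED TEXT (p. 261 [PDF 5], verbatim).  *"These operators are used to define a localized propagator for the full gauge field at the k-th
step: 𝒟_{k,loc} = Σ_{j=0}^{k−1} H^{L^jη}_{j,loc}C^{(j),L^jη}_{loc}H^{*L^jη}_{j,loc} ≡ Σ_{j=0}^{k−1} G^{(j),η}_{loc}. (2.12) Superscripts L^jη, η, etc.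
indicate the lattice spacing for operators rescaled to nonstandard lattices. This propagator derives its regularity and decay from that of C^{(j)}_{loc}
and H_{k,loc}. Thus |(𝒟_{k,loc}f)(b)| ≦ ce^{−c dist(supp f, b)}‖f‖_∞ (2.13) and similarly for derivatives of 𝒟_{k,loc} and Hölder derivatives of order
less than 2. Furthermore, 𝒟_{k,loc}(b₁,b₂) = 0 for dist(b₁,b₂) ≧ ½r(e_k), and 𝒟_{k,loc} is close to 𝒟_k, see (5.4.3) below."*  p. 260: *"Construct
a translation invariant localization function ζ_k such that ζ_k(b,b′) = 0, if dist(b,b′) ≧ ⅛r(e_k), 1, if dist(b,b′) ≦ (1/16)r(e_k), (2.1) and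
such that ζ_k is a smooth function of b. … H_{k,loc}(b,b′) = ζ_k(b,b′)H_k(b,b′). (2.4)"*  [I] (7.2.2) p. 325: *"there exists δ > 0 and for 0 ≦ α < 1
a constant M = M(α) < ∞ such that for |x − x′| ≦ 1, |H_{k,μν}(x,y)| + |∇H_{k,μν}(x,y)| + |x − x′|^{−α}|∇H_{k,μν}(x,y) − ∇H_{k,μν}(x′,y)| ≦ Me^{−δ|x−y|}"*;
p. 326: *"The operators 𝒟_k have the same properties as the operators G_k in [6I], Proposition 1.2, with exponential decay but singularities on the
diagonal"*.

THE OBJECT AND THE READING (kind «model instance with a print-faithful cutoff»; conventions of the torus files, nothing new).  Tori of the series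
(`Balaban1983to89.Setup`/`Params`, standing range `k ≤ m + K`; `η`-bonds `PBond P 0`, scale-`j` unit lattice `PBond P j`).  The (2.12) of record is
r18 g10's `dkLocKer w c ρ k b b″ = Σ_{j<k}Σ_{b₁b₂}H_{j,loc}(b,b₁)C^{(j)}_{loc}(b₁,b₂)H_{j,loc}(b″,b₂)` whose `H_{j,loc} = hlKer` composes p13's `C^∞`
profile with the SUP-NORM block distance — Lipschitz, not `C²`, in `b`, so that object has no `k`-uniform Hölder member of order `1 + α` (p08 g9,
`C2S14-CLOSURE.md` §3 item 5).  Print asks for *"a smooth function of b"*: r18 g21's PRODUCT-FORM cutoff `ζ^Π_j` (`zetaPi`, same 0/1 regions (2.1),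
lattice-`C²` in `b`) gives `H^Π_{j,loc} = hlKerPi = ζ^Π_j·H_j` with all three (I.7.2.2)-type members (§6–§8 there).  THIS FILE puts `H^Π_{j,loc}` into
(2.12): `𝒟^Π_{k,loc}(b,b″) := Σ_{j<k}Σ_{b₁b₂}H^Π_{j,loc}(b,b₁)·C^{(j)}_{loc}(b₁,b₂)·H^Π_{j,loc}(b″,b₂)` (`dkLocKerPi`; the same `C^{(j)}_{loc}` of
record `clKer` = p09's `Cloc` rescaled, the same printed radii `ρ_j/16 < ρ_j/8` for `ζ_j` and `ρ_j/4` for `C̃^{(j)}`, `ρ_j = r(e_j)` the schedule),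
and proves for it the value, derivative AND Hölder members of (2.13) in p08's kernel form: `dist_k(b,b″) = |b₋ − b″₋|_∞/L^k` (`kdist`), forward
`η`-differences `Δ_λF(⟨x,μ⟩) = F(⟨x+ηe_λ,μ⟩) − F(⟨x,μ⟩)` in the output bond, `∇ = η⁻¹Δ = L^kΔ`, Hölder quotients `(|x − x′|_∞/L^k)^{−α}|∇F(x) − ∇F(x′)|`
for `x ≠ x′`, `|x − x′|_∞/L^k ≤ 1` — the shape of (I.7.2.2) and of p08's `holderDk_torus_prop12` for `𝒟_k`.

WHAT IS PROVED (kernel-checked; 2 `def`s with bodies + theorems; 0 `sorry`; NO `Prop`-valued fact; standard axioms):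
* §1 **THE FORK**: `termKerPi`, `dkLocKerPi` (DEFINITIONS), `dkLocKerPi_eq_sum`, `dkLocKerPi_succ`; `hlKerPi_eq_zero_of_le` / `hdist_lt_of_hlKerPi_ne_zero`
  ((2.6) for `H^Π_{j,loc}`); **«𝒟_{k,loc}(b₁,b₂) = 0 for dist(b₁,b₂) ≧ ½r(e_k)» FOR THE FORK**: `termKerPi_eq_zero_of_far`, `dkLocKerPi_eq_zero_of_far`,
  `vanishes_dkLocKerPi` (range `ρ_k/2 + 4` in units of `T₁^{(k)}` under `0 < ρ_j`, `L^jρ_j ≤ L^kρ_k` — the `+4` is the one-block spread of the (2.9)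
  sandwich, as for the object of record).
* §2 `abs_secondDiff_le_of_bounds` — the double difference of a lattice function with a gradient bound and an order-`(1+α)` Hölder bound at scale `j`:
  `L^j|ΔF(x) − ΔF(x′)| ≤ r^α(M + M_α)(e^{−δE(x)} + e^{−δE(x′)})`, `r = |x − x′|_∞/L^j` (Hölder for `r ≤ 1`, gradient twice and `r^α ≥ 1` for `r > 1`;
  p08's `abs_secondDiff_H_le` made generic).
* §3 THE SCALE-`j` TERMS at the weights of step `k`: `abs_triple_le_twoExp` (three-kernel sum whose first factor is bounded by TWO exponentials),
  `abs_termPi_le` (value), `abs_gradTermPi_le` (derivative), **`abs_holderTermPi_le`** (Hölder): `≤ L^{−j}r_j^α(M + M_α)M·M_C(L^{k−j})^{d−2}·d²e^{a/2}K(a)²·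
  (e^{−a·dist_j(x,b″)} + e^{−a·dist_j(x′,b″)})`, `a = min(δ,δ_C)/2`, from the three members for `H^Π_{j,loc}` and the decay of `C^{(j)}_{loc}`.
* §4 THE MULTISCALE SUMS (p08's `abs_sum_scales_le`): **`abs_dkLocKerPi_le`** (value, `dist_k ≥ 2`), **`abs_dkLocKerPi_shift_sub_le`** (derivative,
  `dist_k ≥ 2`), **`abs_dkLocKerPi_secondDiff_le`** (Hölder: for `x ≠ x′`, `|x − x′|_∞/L^k ≤ 1`, `D = dist_k(⟨x,μ⟩,b″) ≥ 3`, `0 ≤ α ≤ 1`: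
  `|Δ_λ𝒟^Π_{k,loc}(⟨x,μ⟩,b″) − Δ_λ𝒟^Π_{k,loc}(⟨x′,μ⟩,b″)| ≤ L^{−k}(|x − x′|_∞/L^k)^α·2(M + M_α)MM_C·d²e^{a/2}K(a)²·(d+1)!/a^{d+1}·e^{−(a/2)(D−1)}`) — explicit
  constants under displayed per-scale hypotheses, UNIFORM IN `k` and in the schedule.
* §5 **HYPOTHESIS-FREE OVER ALL TORI, ONE SET OF CONSTANTS** (`2 ≤ d`; every torus `P` with `P.d = d`, `P.L = L`; every `k ≤ m + K`; every schedule
  with `ρ_j ≥ 16` and `ρ_jL^j/4 + 3 ≤ |T_η|` for `j < k` — gen 21's `printedRadii_admissible`): **`holderDkLocPi_allTori`** `∃ R₀ c₂ δ′, 0 < δ′ ∧ 0 ≤ c₂ ∧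
  … L^k·|Δ_λ𝒟^Π_{k,loc}(⟨x,μ⟩,b″) − Δ_λ𝒟^Π_{k,loc}(⟨x′,μ⟩,b″)| ≤ c₂(|x − x′|_∞/L^k)^αe^{−δ′dist_k}` for `x ≠ x′`, `|x − x′|_∞/L^k ≤ 1`, `dist_k ≥ R₀`;
  **`gradDkLocPi_allTori`** (`L^k|Δ_λ𝒟^Π_{k,loc}| ≤ c₁e^{−δ′dist_k}`), **`decayDkLocPi_allTori`** (`|𝒟^Π_{k,loc}| ≤ c₀e^{−δ′dist_k}`) — inputs BY NAME:
  gen 21's `exists_holderBounds_allTori` ([6I] Prop. 1.2 over all tori, p19, inside) fed through `holder25/deriv25_zetaPi_of_bounds`, p09 g8's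
  `(d, L)`-only `cloc_decay`: (I.7.2.2)'s *"constants independent of k, T_η"* carried to the Hölder clause of (2.13).
HONEST SCOPE.  (i) The object of record `BIJ88CurlyDkLocTorus.dkLocKer` (sup-norm cutoff) is NOT modified and the Hölder member is NOT claimed for
it; `dkLocKerPi` is its twin with the smooth cutoff print asks for (same `H_j`, same `C^{(j)}_{loc}`, same 0/1 regions); heads of rows C2.Eq2.12/2.13
unchanged.  (ii) «Hölder derivatives of order less than 2» = ONE forward `η`-difference in the OUTPUT bond plus a Hölder quotient of order `0 ≤ α < 1`
of it, beyond a threshold `dist_k ≥ R₀` (print: *"singularities on the diagonal"* for `𝒟_k`; no short-distance statement here), as p08 states it for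
`𝒟_k`; backward differences / the input bond are not treated.  (iii) «𝒟_{k,loc} is close to 𝒟_k, see (5.4.3)» is NOT proved for the fork in this
file (for the object of record: p08's `BIJ88CurlyDkLocCloseTorus`); the (2.7)-type smallness of `H^Π_{j,loc} − H_j` it needs is gen 21's
`holder27_hlKerPi_allTori`/`eq25_26_27_hlKerPi`.  (iv) Radii: the Hölder input for `ζ^Π_jH_j` needs the annulus `[ρ_j/16, ρ_j/8]` at least one unit
wide, the inner radius at least one fine step and the outer radius before the antipode — `ρ_j ≥ 16`, `ρ_jL^j/4 + 3 ≤ |T_η|`; print has `r(e_j) → ∞`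
and tori much larger than `r(e_k)L^k`.  (v) Constants explicit in §3–§4 (not optimal); in §5 existential, depending on `(d, L, α)` only (`C_σ` of
the smooth transition by compactness, `(δ, M)` of (I.7.2.2) from Prop. 1.2 over all tori).  (vi) `U = 1`, real abelian fields, tori of the
series, standing range `k ≤ m + K`, every `d ≥ 2`.  NOT summit progress; NOT continuum; NOT Clay.  Unit `lit-balaban-r18`
(literature-prover-lit-balaban-r18-g30-0), 2026-08-23.
-/

open scoped BigOperators RealInnerProductSpace

namespace Literature.MathematicalPhysics.QuantumFieldTheory.BalabanImbrieJaffe1984to88.BIJ88CurlyDkLocHolderTorus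

open Balaban1983to89 hiding Site Plaq
open Balaban1983to89.LatticeFieldCalculus
open Balaban1983to89.B3TorusRadialSums (supDist_eq_zero_iff supDist_comm)
open BIJ85Prop521Torus BIJ85Prop522Torus BIJ85Sigma422Eta
open BIJ85Sect7Statements BIJ85Ineq722Torus
open BIJ85Ineq722DeltaA (deltaAData)
open BIJ88Sect2Statements (Vanishes)
open BIJ88ClocFactorsTorus (distB distB_apply)
open BIJ88ClocEstimatesTorus (Cloc cloc_decay)
open BIJ88Decay216Torus (triple_sum_le)
open BIJ88CurlyDkLocTorus (hKer hdist clKer kdist bdist_le_of_clKer_ne_zero)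
open BIJ88CurlyDkLocDecayTorus (abs_triple_le abs_clKer_ambient_le abs_sum_scales_le)
open BIJ88CurlyDkLocGradTerm (abs_triple_le₂)
open BIJ88HkLocHolderTorus
open Literature.Analysis.Calculus (exists_abs_deriv_and_deriv_deriv_smoothTransition_le)
-- inside this namespace the bare `Site`/`Plaq` are the `ℤ^d` carriers of the QFT root; the torus ones are renamed:
open Balaban1983to89 renaming Site → TSite, Plaq → TPlaq

noncomputable section

variable {P : Params}

/-- `0 < L^n` on the tori. [folklore] -/
private theorem cast_pow_L_pos' (n : ℕ) : (0 : ℝ) < (P.L : ℝ) ^ n := pow_pos P.cast_L_pos n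

/-- `L^k = L^j·L^{k−j}` for `j ≤ k`. [folklore] -/
private theorem pow_eq_pow_mul_pow' {j k : ℕ} (hjk : j ≤ k) : (P.L : ℝ) ^ k = (P.L : ℝ) ^ j * (P.L : ℝ) ^ (k - j) := by
  rw [← pow_add, Nat.add_sub_cancel' hjk]

/-- `a(a⁻¹bce) = bce` for `a ≠ 0`. [folklore] -/
private theorem mul_inv_cancel_assoc₃ {a b c e : ℝ} (ha : a ≠ 0) : a * (a⁻¹ * b * c * e) = b * c * e := by
  rw [show a⁻¹ * b * c * e = a⁻¹ * (b * c * e) by ring, mul_inv_cancel_left₀ ha]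

/-- `a(a⁻¹bcef) = bcef` for `a ≠ 0`. [folklore] -/
private theorem mul_inv_cancel_assoc₄ {a b c e f : ℝ} (ha : a ≠ 0) : a * (a⁻¹ * b * c * e * f) = b * c * e * f := by
  rw [show a⁻¹ * b * c * e * f = a⁻¹ * (b * c * e * f) by ring, mul_inv_cancel_left₀ ha]

/-! ## §1  The fork: (2.12) with print's smooth-in-`b` cutoff at every scale, and its finite range -/

/-- **the scale-`j` term of (2.12) with the smooth cutoff**: `G^{(j),η,Π}_{loc}(b, b″) = Σ_{b₁,b₂∈T^{(j)}} H^Π_{j,loc}(b, b₁)·C^{(j)}_{loc}(b₁, b₂)·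
H^Π_{j,loc}(b″, b₂)` — r18 g10's `termKer` with gen 21's `hlKerPi = ζ^Π_j·H_j` (radii `ρ_j/16 < ρ_j/8`, (2.1)) in place of `hlKer`; the `C^{(j)}_{loc}` of
record `clKer` at radius `ρ_j/4` ((2.8)/(2.9)). [cite: BalabanImbrieJaffe1988, (2.12) p.261] -/
def termKerPi (w c : ℝ) (ρ : ℕ → ℝ) (j : ℕ) (b b'' : PBond P 0) : ℝ :=
  ∑ b₁ : PBond P j, ∑ b₂ : PBond P j,
    hlKerPi w c (ρ j / 16) (ρ j / 8) j b b₁ * clKer w c (ρ j / 4) j b₁ b₂ * hlKerPi w c (ρ j / 16) (ρ j / 8) j b'' b₂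

/-- **(2.12) WITH PRINT'S SMOOTH CUTOFF ON THE TORUS**: `𝒟^Π_{k,loc}(b, b″) = Σ_{j<k} Σ_{b₁,b₂∈T^{(j)}} H^Π_{j,loc}(b, b₁)·C^{(j)}_{loc}(b₁, b₂)·H^Π_{j,loc}(b″, b₂)`
(`b`, `b″` `η`-bonds; weights `(w, c)` free — print evaluates at the weights `(η_k^d, L^k)` of step `k`; `ρ` = the radius schedule `r(e_j)`) — the
twin of the object of record `BIJ88CurlyDkLocTorus.dkLocKer` with *"a smooth function of b"* as cutoff. [cite: BalabanImbrieJaffe1988, (2.12) p.261] -/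
def dkLocKerPi (w c : ℝ) (ρ : ℕ → ℝ) (k : ℕ) (b b'' : PBond P 0) : ℝ :=
  ∑ j ∈ Finset.range k, termKerPi w c ρ j b b''

/-- (2.12) as the sum of its scale terms `≡ Σ_{j<k} G^{(j),η}_{loc}`. [cite: BalabanImbrieJaffe1988, (2.12) p.261] -/
theorem dkLocKerPi_eq_sum (w c : ℝ) (ρ : ℕ → ℝ) (k : ℕ) (b b'' : PBond P 0) :
    dkLocKerPi (P := P) w c ρ k b b'' = ∑ j ∈ Finset.range k, termKerPi w c ρ j b b'' := rfl

/-- the recursion in `k` (cf. (5.5.11) p. 285), entrywise. [cite: BalabanImbrieJaffe1988, (2.12) p.261] -/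
theorem dkLocKerPi_succ (w c : ℝ) (ρ : ℕ → ℝ) (k : ℕ) (b b'' : PBond P 0) :
    dkLocKerPi (P := P) w c ρ (k + 1) b b'' = dkLocKerPi w c ρ k b b'' + termKerPi w c ρ k b b'' := by
  rw [dkLocKerPi_eq_sum, dkLocKerPi_eq_sum, Finset.sum_range_succ]

/-- unfolding the scale term. [cite: BalabanImbrieJaffe1988, (2.12) p.261] -/
theorem termKerPi_eq_sum (w c : ℝ) (ρ : ℕ → ℝ) (j : ℕ) (b b'' : PBond P 0) :
    termKerPi (P := P) w c ρ j b b'' = ∑ b₁ : PBond P j, ∑ b₂ : PBond P j,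
      hlKerPi w c (ρ j / 16) (ρ j / 8) j b b₁ * clKer w c (ρ j / 4) j b₁ b₂ * hlKerPi w c (ρ j / 16) (ρ j / 8) j b'' b₂ := rfl

/-- **(2.6) FOR `H^Π_{j,loc}`**: the smooth cutoff vanishes beyond the outer radius (gen 21's `isCutoff_zetaPiB`), hence so does `H^Π_{j,loc}(b, b₁)`
for `dist(b, b₁) ≥ R₀` (`R₁ < R₀`). [cite: BalabanImbrieJaffe1988, (2.6) p.260] -/
theorem hlKerPi_eq_zero_of_le {w c R₁ R₀ : ℝ} (hR : R₁ < R₀) {j : ℕ} {b : PBond P 0} {b₁ : PBond P j}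
    (h : R₀ ≤ hdist (P := P) j b b₁) : hlKerPi (P := P) w c R₁ R₀ j b b₁ = 0 := by
  have hz : zetaPiB (P := P) R₁ R₀ j b b₁ = 0 := (isCutoff_zetaPiB (P := P) hR j).2 b b₁ h
  unfold zetaPiB at hz
  rw [hlKerPi_apply, hz, zero_mul]

/-- contrapositive: `H^Π_{j,loc}(b, b₁) ≠ 0 ⟹ dist(b, b₁) < R₀`. [cite: BalabanImbrieJaffe1988, (2.6) p.260] -/
theorem hdist_lt_of_hlKerPi_ne_zero {w c R₁ R₀ : ℝ} (hR : R₁ < R₀) {j : ℕ} {b : PBond P 0} {b₁ : PBond P j}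
    (h : hlKerPi (P := P) w c R₁ R₀ j b b₁ ≠ 0) : hdist (P := P) j b b₁ < R₀ := by
  by_contra hle
  exact h (hlKerPi_eq_zero_of_le hR (not_lt.1 hle))

/-- `|H^Π_{j,loc}(b, b₁)| ≤ |H_j(b, b₁)|` (`0 ≤ ζ^Π_j ≤ 1`). [cite: BalabanImbrieJaffe1988, (2.5) p.260] -/
theorem abs_hlKerPi_le_abs (w c R₁ R₀ : ℝ) (j : ℕ) (b : PBond P 0) (b₁ : PBond P j) :
    |hlKerPi (P := P) w c R₁ R₀ j b b₁| ≤ |hKer w c j b b₁| := by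
  rw [hlKerPi_apply, abs_mul]
  exact mul_le_of_le_one_left (abs_nonneg _) (abs_zetaPi_le_one R₁ R₀ j b.src b₁.src)

/-- **the range of the scale-`j` term of the fork**: for `0 < ρ_j` and `j + 1 ≤ m + K`, `G^{(j),η,Π}_{loc}(b, b″) = 0` whenever
`|b₋ − b″₋|_∞ ≥ L^j(ρ_j/2 + 4L − 4)` — the ranges `ρ_j/8` of `ζ^Π_j` (twice) and `ρ_j/4 + (4L − 4)` of `C^{(j)}_{loc}` in units of `T₁^{(j)}` add up
along `b₋ → y_{b₁₋} → y_{b₂₋} → b″₋` (r18 g10's `termKer_eq_zero_of_far` for the smooth cutoff, same 0/1 regions). [cite: BalabanImbrieJaffe1988, (2.13) p.261] -/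
theorem termKerPi_eq_zero_of_far {w c : ℝ} {ρ : ℕ → ℝ} {j : ℕ} (hj : j + 1 ≤ P.m + P.K) (hρ : 0 < ρ j) {b b'' : PBond P 0}
    (hfar : (P.L : ℝ) ^ j * (ρ j / 2 + (4 * P.L - 4 : ℕ)) ≤ (supDist b.src b''.src : ℝ)) :
    termKerPi (P := P) w c ρ j b b'' = 0 := by
  have hj' : j ≤ P.m + P.K := by omega
  have hR : ρ j / 16 < ρ j / 8 := by linarith
  have hLj := cast_pow_L_pos' (P := P) j
  unfold termKerPi
  refine Finset.sum_eq_zero fun b₁ _ => Finset.sum_eq_zero fun b₂ _ => ?_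
  by_contra hne
  have h1 : hlKerPi (P := P) w c (ρ j / 16) (ρ j / 8) j b b₁ ≠ 0 := left_ne_zero_of_mul (left_ne_zero_of_mul hne)
  have h2 : clKer (P := P) w c (ρ j / 4) j b₁ b₂ ≠ 0 := right_ne_zero_of_mul (left_ne_zero_of_mul hne)
  have h3 : hlKerPi (P := P) w c (ρ j / 16) (ρ j / 8) j b'' b₂ ≠ 0 := right_ne_zero_of_mul hne
  have d1 := hdist_lt_of_hlKerPi_ne_zero hR h1
  have d2 := bdist_le_of_clKer_ne_zero hj h2
  have d3 := hdist_lt_of_hlKerPi_ne_zero hR h3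
  unfold hdist distEU at d1 d3
  unfold BIJ88CurlyDkLocTorus.bdist at d2
  rw [div_lt_iff₀ hLj] at d1 d3
  have e2 : (supDist (ctr j b₁.src) (ctr j b₂.src) : ℝ) = (P.L : ℝ) ^ j * (supDist b₁.src b₂.src : ℝ) := by
    rw [supDist_ctr_ctr hj']; push_cast; ring
  have t1 := supDist_triangle b.src (ctr j b₁.src) b''.src
  have t2 := supDist_triangle (ctr j b₁.src) (ctr j b₂.src) b''.src
  have t3 : supDist (ctr j b₂.src) b''.src = supDist b''.src (ctr j b₂.src) := supDist_comm _ _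
  have hsum : (supDist b.src b''.src : ℝ) ≤ (supDist b.src (ctr j b₁.src) : ℝ) + (supDist (ctr j b₁.src) (ctr j b₂.src) : ℝ)
      + (supDist b''.src (ctr j b₂.src) : ℝ) := by
    rw [← t3]; exact_mod_cast t1.trans (by omega)
  rw [e2] at hsum
  have hmid : (P.L : ℝ) ^ j * (supDist b₁.src b₂.src : ℝ) ≤ (P.L : ℝ) ^ j * (ρ j / 4 + ((4 * P.L - 4 : ℕ) : ℝ)) :=
    mul_le_mul_of_nonneg_left d2 hLj.le
  have key : (supDist b.src b''.src : ℝ) < (P.L : ℝ) ^ j * (ρ j / 2 + ((4 * P.L - 4 : ℕ) : ℝ)) := by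
    have := add_lt_add (add_lt_add_of_lt_of_le d1 hmid) d3
    nlinarith
  exact absurd hfar (not_le.2 key)

/-- **«𝒟_{k,loc}(b₁,b₂) = 0 for dist(b₁,b₂) ≧ ½r(e_k)» FOR THE FORK**: for a radius schedule with `0 < ρ_j` and the scale monotonicity
`L^jρ_j ≤ L^kρ_k` (`j < k`; (2.2)–(2.3)) and `k ≤ m + K`, `𝒟^Π_{k,loc}(b, b″) = 0` whenever `dist_k(b, b″) ≥ ρ_k/2 + 4` — the printed `½r(e_k)` plus the
one-block spread of the (2.9) averages, exactly as for the object of record. [cite: BalabanImbrieJaffe1988, (2.13) p.261] -/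
theorem dkLocKerPi_eq_zero_of_far {w c : ℝ} {ρ : ℕ → ℝ} {k : ℕ} (hk : k ≤ P.m + P.K) (hρ0 : ∀ j < k, 0 < ρ j)
    (hρ : ∀ j < k, (P.L : ℝ) ^ j * ρ j ≤ (P.L : ℝ) ^ k * ρ k) {b b'' : PBond P 0} (hfar : ρ k / 2 + 4 ≤ kdist (P := P) k b b'') :
    dkLocKerPi (P := P) w c ρ k b b'' = 0 := by
  have hLk := cast_pow_L_pos' (P := P) k
  unfold kdist at hfar
  rw [le_div_iff₀ hLk] at hfar
  rw [dkLocKerPi_eq_sum]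
  refine Finset.sum_eq_zero fun j hj => ?_
  rw [Finset.mem_range] at hj
  refine termKerPi_eq_zero_of_far (by omega) (hρ0 j hj) (le_trans ?_ hfar)
  have hLj := cast_pow_L_pos' (P := P) j
  have hL1 : (1 : ℝ) ≤ P.L := by exact_mod_cast P.L_pos
  have hmono := hρ j hj
  have hpow : (P.L : ℝ) ^ (j + 1) ≤ (P.L : ℝ) ^ k := pow_le_pow_right₀ hL1 (by omega)
  have hcast : ((4 * P.L - 4 : ℕ) : ℝ) = 4 * (P.L : ℝ) - 4 := by
    have : 4 ≤ 4 * P.L := by have := P.L_pos; omega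
    push_cast [Nat.cast_sub this]
    ring
  rw [hcast]
  rw [pow_succ] at hpow
  nlinarith

/-- the same in r18's typed vocabulary: **`Vanishes dist_k 𝒟^Π_{k,loc} (ρ_k/2 + 4)`**. [cite: BalabanImbrieJaffe1988, (2.13) p.261] -/
theorem vanishes_dkLocKerPi {w c : ℝ} {ρ : ℕ → ℝ} {k : ℕ} (hk : k ≤ P.m + P.K) (hρ0 : ∀ j < k, 0 < ρ j)
    (hρ : ∀ j < k, (P.L : ℝ) ^ j * ρ j ≤ (P.L : ℝ) ^ k * ρ k) :
    Vanishes (kdist (P := P) k) (dkLocKerPi (P := P) w c ρ k) (ρ k / 2 + 4) :=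
  fun _ _ h => dkLocKerPi_eq_zero_of_far hk hρ0 hρ h

/-! ## §2  The double difference of a lattice function with gradient and Hölder bounds at scale `j` -/

/-- **THE DOUBLE DIFFERENCE AT TWO SITES `x ≠ x′`** of a lattice function `F` obeying, at scale `j`, a gradient bound `‖λ ↦ L^j(F(z+e_λ) − F(z))‖ ≤
Me^{−δE(z)}` and the Hölder bound `|x − x′|^{−α}‖∇F(x) − ∇F(x′)‖ ≤ M_αe^{−δE(x)}` for `|x − x′| = |x − x′|_∞/L^j ≤ 1`: with `r = |x − x′|_∞/L^j`,
`L^j·|ΔF_λ(x) − ΔF_λ(x′)| ≤ r^α·(M + M_α)(e^{−δE(x)} + e^{−δE(x′)})` — the Hölder member for `r ≤ 1`, the gradient member twice and `r^α ≥ 1` for `r > 1`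
(p08's `BIJ85CurlyDkHolderTerm.abs_secondDiff_H_le`, made generic in `F`). [cite: BalabanImbrieJaffe1985, (7.2.2) p.325] -/
theorem abs_secondDiff_le_of_bounds {j : ℕ} {δ M Mα α : ℝ} (hM : 0 ≤ M) (hMα : 0 ≤ Mα) (hα : 0 ≤ α) {F E : TSite P 0 → ℝ}
    (hB : ∀ z : TSite P 0, ‖fun lam : Fin P.d => (P.L : ℝ) ^ j * (F (z.shift lam) - F z)‖ ≤ M * Real.exp (-(δ * E z)))
    {x x' : TSite P 0} (hne : x ≠ x')
    (hHol : (supDist x x' : ℝ) / (P.L : ℝ) ^ j ≤ 1 →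
      ((supDist x x' : ℝ) / (P.L : ℝ) ^ j) ^ (-α) *
          ‖fun lam : Fin P.d => (P.L : ℝ) ^ j * (F (x.shift lam) - F x) - (P.L : ℝ) ^ j * (F (x'.shift lam) - F x')‖ ≤
        Mα * Real.exp (-(δ * E x)))
    (lam : Fin P.d) :
    (P.L : ℝ) ^ j * |(F (x.shift lam) - F x) - (F (x'.shift lam) - F x')| ≤
      ((supDist x x' : ℝ) / (P.L : ℝ) ^ j) ^ α * ((M + Mα) * (Real.exp (-(δ * E x)) + Real.exp (-(δ * E x')))) := by
  have hLj : 0 < (P.L : ℝ) ^ j := cast_pow_L_pos' j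
  set r : ℝ := (supDist x x' : ℝ) / (P.L : ℝ) ^ j
  have hS : 0 < (supDist x x' : ℝ) := by
    have h0 : supDist x x' ≠ 0 := fun h => hne ((supDist_eq_zero_iff x x').1 h)
    exact_mod_cast Nat.pos_of_ne_zero h0
  have hr0 : 0 < r := div_pos hS hLj
  have hex : 0 < Real.exp (-(δ * E x)) := Real.exp_pos _
  have hex' : 0 < Real.exp (-(δ * E x')) := Real.exp_pos _
  -- the gradient member, componentwise
  have hg : ∀ z : TSite P 0, (P.L : ℝ) ^ j * |F (z.shift lam) - F z| ≤ M * Real.exp (-(δ * E z)) := by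
    intro z
    have h1 := (norm_le_pi_norm (fun lam' : Fin P.d => (P.L : ℝ) ^ j * (F (z.shift lam') - F z)) lam).trans (hB z)
    rwa [Real.norm_eq_abs, abs_mul, abs_of_pos hLj] at h1
  by_cases hr1 : r ≤ 1
  · -- near: the Hölder member
    have h := hHol hr1
    have hrα : 0 < r ^ α := Real.rpow_pos_of_pos hr0 α
    rw [Real.rpow_neg hr0.le, inv_mul_le_iff₀ hrα] at h
    have h1 := (norm_le_pi_norm (fun lam' : Fin P.d => (P.L : ℝ) ^ j * (F (x.shift lam') - F x) -
      (P.L : ℝ) ^ j * (F (x'.shift lam') - F x')) lam).trans h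
    rw [Real.norm_eq_abs, ← mul_sub, abs_mul, abs_of_pos hLj] at h1
    refine h1.trans (mul_le_mul_of_nonneg_left ?_ hrα.le)
    nlinarith [hM, hMα, hex, hex']
  · -- far: the gradient member twice, `r^α ≥ 1`
    have hr1' : 1 ≤ r := le_of_lt (not_le.1 hr1)
    have hrα : 1 ≤ r ^ α := Real.one_le_rpow hr1' hα
    have h1 := hg x
    have h2 := hg x'
    calc (P.L : ℝ) ^ j * |(F (x.shift lam) - F x) - (F (x'.shift lam) - F x')|
        ≤ (P.L : ℝ) ^ j * (|F (x.shift lam) - F x| + |F (x'.shift lam) - F x'|) :=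
          mul_le_mul_of_nonneg_left (abs_sub _ _) hLj.le
      _ ≤ M * Real.exp (-(δ * E x)) + M * Real.exp (-(δ * E x')) := by rw [mul_add]; exact add_le_add h1 h2
      _ ≤ 1 * ((M + Mα) * (Real.exp (-(δ * E x)) + Real.exp (-(δ * E x')))) := by
          rw [one_mul]; nlinarith [hM, hMα, hex, hex']
      _ ≤ _ := mul_le_mul_of_nonneg_right hrα (by positivity)

/-! ## §3  The scale-`j` terms at the weights of step `k` -/

/-- `Σ_b f(b₋) = d·Σ_y f(y)` on `T^{(j)}`. [folklore] -/
private theorem sum_bond_src {j : ℕ} (f : TSite P j → ℝ) : ∑ b : PBond P j, f b.src = (P.d : ℝ) * ∑ y : TSite P j, f y := by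
  rw [← Fintype.sum_equiv (LatticeFieldCalculus.bondEquiv (P := P) (j := j)) (fun q : TSite P j × Fin P.d => f q.1) _
    (fun q => rfl), Fintype.sum_prod_type]
  simp only [Finset.sum_const, Finset.card_univ, Fintype.card_fin, nsmul_eq_mul]
  rw [Finset.mul_sum]

/-- p08 g7's three-kernel lattice sum `triple_sum_le` read over unit bonds (a factor `d²` for the directions). [folklore] -/
private theorem sum_bond_triple_le {j : ℕ} (hj : j ≤ P.m + P.K) {δ δC : ℝ} (hδ : 0 < δ) (hδC : 0 < δC) (z x₂ : TSite P 0) :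
    ∑ b₁ : PBond P j, ∑ b₂ : PBond P j, Real.exp (-(δ * distEU P j z b₁.src)) * Real.exp (-(δC * (supDist b₁.src b₂.src : ℝ))) *
        Real.exp (-(δ * distEU P j x₂ b₂.src)) ≤
      (P.d : ℝ) ^ 2 * (Real.exp (min δ δC / 2 / 2) * ((2 * (1 + P.d / (min δ δC / 2))) ^ P.d) ^ 2) *
        Real.exp (-(min δ δC / 2 * ((supDist z x₂ : ℝ) / (P.L : ℝ) ^ j))) := by
  rw [sum_bond_src (fun y => ∑ b₂ : PBond P j, Real.exp (-(δ * distEU P j z y)) * Real.exp (-(δC * (supDist y b₂.src : ℝ))) *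
    Real.exp (-(δ * distEU P j x₂ b₂.src)))]
  have e : ∀ y : TSite P j, ∑ b₂ : PBond P j, Real.exp (-(δ * distEU P j z y)) * Real.exp (-(δC * (supDist y b₂.src : ℝ))) *
      Real.exp (-(δ * distEU P j x₂ b₂.src)) = (P.d : ℝ) * ∑ y' : TSite P j, Real.exp (-(δ * distEU P j z y)) *
        Real.exp (-(δC * (supDist y y' : ℝ))) * Real.exp (-(δ * distEU P j x₂ y')) := fun y =>
    sum_bond_src (fun y' => Real.exp (-(δ * distEU P j z y)) * Real.exp (-(δC * (supDist y y' : ℝ))) *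
      Real.exp (-(δ * distEU P j x₂ y')))
  simp only [e]
  rw [← Finset.mul_sum, ← mul_assoc, ← sq, mul_assoc]
  exact mul_le_mul_of_nonneg_left (triple_sum_le hj hδ hδC z x₂) (by positivity)

/-- **a three-kernel sum whose first factor carries TWO exponentials** (the double differences of §2 are bounded at `x` AND at `x′`): if
`|E(b₁)| ≤ A(e^{−δ dist_j(x,b₁)} + e^{−δ dist_j(x′,b₁)})`, `|C(b₁,b₂)| ≤ M_Ce^{−δ_C|b₁₋−b₂₋|_∞}`, `|h′(b″,b₂)| ≤ M′e^{−δ dist_j(b″,b₂)}`, then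
`|Σ_{b₁b₂}E(b₁)C(b₁,b₂)h′(b″,b₂)| ≤ AM′M_C·d²e^{a/2}K(a)²·(e^{−a|x−b″₋|_∞/L^j} + e^{−a|x′−b″₋|_∞/L^j})`, `a = min(δ,δ_C)/2` (p08's two triple sums).
[cite: BalabanImbrieJaffe1988, (2.12) p.261] -/
theorem abs_triple_le_twoExp {j : ℕ} (hj : j ≤ P.m + P.K) {δ A M' δC MC : ℝ} (hδ : 0 < δ) (hδC : 0 < δC) (hA : 0 ≤ A) (hM' : 0 ≤ M')
    (hMC : 0 ≤ MC) {x x' : TSite P 0} {E : PBond P j → ℝ} {h' : PBond P 0 → PBond P j → ℝ} {C : PBond P j → PBond P j → ℝ}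
    (hE : ∀ b₁ : PBond P j, |E b₁| ≤ A * (Real.exp (-(δ * distEU P j x b₁.src)) + Real.exp (-(δ * distEU P j x' b₁.src))))
    (hH' : ∀ (b₀ : PBond P 0) (b₁ : PBond P j), |h' b₀ b₁| ≤ M' * Real.exp (-(δ * distEU P j b₀.src b₁.src)))
    (hC : ∀ b₁ b₂ : PBond P j, |C b₁ b₂| ≤ MC * Real.exp (-(δC * (supDist b₁.src b₂.src : ℝ))))
    (b'' : PBond P 0) :
    |∑ b₁ : PBond P j, ∑ b₂ : PBond P j, E b₁ * C b₁ b₂ * h' b'' b₂| ≤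
      A * M' * MC * ((P.d : ℝ) ^ 2 * (Real.exp (min δ δC / 2 / 2) * ((2 * (1 + P.d / (min δ δC / 2))) ^ P.d) ^ 2)) *
        (Real.exp (-(min δ δC / 2 * ((supDist x b''.src : ℝ) / (P.L : ℝ) ^ j))) +
          Real.exp (-(min δ δC / 2 * ((supDist x' b''.src : ℝ) / (P.L : ℝ) ^ j)))) := by
  set K : ℝ := (P.d : ℝ) ^ 2 * (Real.exp (min δ δC / 2 / 2) * ((2 * (1 + P.d / (min δ δC / 2))) ^ P.d) ^ 2) with hK
  have hpt : ∀ b₁ b₂ : PBond P j, |E b₁ * C b₁ b₂ * h' b'' b₂| ≤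
      A * M' * MC * (Real.exp (-(δ * distEU P j x b₁.src)) * Real.exp (-(δC * (supDist b₁.src b₂.src : ℝ))) *
          Real.exp (-(δ * distEU P j b''.src b₂.src)) +
        Real.exp (-(δ * distEU P j x' b₁.src)) * Real.exp (-(δC * (supDist b₁.src b₂.src : ℝ))) *
          Real.exp (-(δ * distEU P j b''.src b₂.src))) := by
    intro b₁ b₂
    rw [abs_mul, abs_mul]
    calc _ ≤ (A * (Real.exp (-(δ * distEU P j x b₁.src)) + Real.exp (-(δ * distEU P j x' b₁.src)))) *
          (MC * Real.exp (-(δC * (supDist b₁.src b₂.src : ℝ)))) * (M' * Real.exp (-(δ * distEU P j b''.src b₂.src))) :=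
          mul_le_mul (mul_le_mul (hE b₁) (hC b₁ b₂) (abs_nonneg _) (by positivity)) (hH' b'' b₂) (abs_nonneg _) (by positivity)
      _ = _ := by ring
  have hT := sum_bond_triple_le hj hδ hδC x b''.src
  have hT' := sum_bond_triple_le hj hδ hδC x' b''.src
  rw [← hK] at hT hT'
  calc _ ≤ ∑ b₁ : PBond P j, ∑ b₂ : PBond P j, A * M' * MC *
          (Real.exp (-(δ * distEU P j x b₁.src)) * Real.exp (-(δC * (supDist b₁.src b₂.src : ℝ))) *
              Real.exp (-(δ * distEU P j b''.src b₂.src)) +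
            Real.exp (-(δ * distEU P j x' b₁.src)) * Real.exp (-(δC * (supDist b₁.src b₂.src : ℝ))) *
              Real.exp (-(δ * distEU P j b''.src b₂.src))) :=
        (Finset.abs_sum_le_sum_abs _ _).trans (Finset.sum_le_sum fun b₁ _ =>
          (Finset.abs_sum_le_sum_abs _ _).trans (Finset.sum_le_sum fun b₂ _ => hpt b₁ b₂))
    _ = A * M' * MC *
          ((∑ b₁ : PBond P j, ∑ b₂ : PBond P j, Real.exp (-(δ * distEU P j x b₁.src)) *
              Real.exp (-(δC * (supDist b₁.src b₂.src : ℝ))) * Real.exp (-(δ * distEU P j b''.src b₂.src))) +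
            ∑ b₁ : PBond P j, ∑ b₂ : PBond P j, Real.exp (-(δ * distEU P j x' b₁.src)) *
              Real.exp (-(δC * (supDist b₁.src b₂.src : ℝ))) * Real.exp (-(δ * distEU P j b''.src b₂.src))) := by
        rw [← Finset.sum_add_distrib, Finset.mul_sum]
        refine Finset.sum_congr rfl fun b₁ _ => ?_
        rw [← Finset.sum_add_distrib, Finset.mul_sum]
    _ ≤ A * M' * MC * (K * Real.exp (-(min δ δC / 2 * ((supDist x b''.src : ℝ) / (P.L : ℝ) ^ j))) +
          K * Real.exp (-(min δ δC / 2 * ((supDist x' b''.src : ℝ) / (P.L : ℝ) ^ j)))) :=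
        mul_le_mul_of_nonneg_left (add_le_add hT hT') (by positivity)
    _ = _ := by ring

/-- **THE SCALE-`j` TERM OF THE FORK (value)** at the weights of step `k` (`j ≤ k`, `j ≤ m + K`, `d ≥ 2`): from the sup member for `H^Π_{j,loc}` and
the decay of the `C^{(j)}_{loc}` of record at radius `ρ_j/4`, `|G^{(j),η,Π}_{loc}(b, b″)| ≤ M²M_C(L^{k−j})^{d−2}·d²e^{a/2}K(a)²·e^{−a|b₋−b″₋|_∞/L^j}`,
`a = min(δ,δ_C)/2` (p08's `abs_triple_le`). [cite: BalabanImbrieJaffe1988, (2.13) p.261] -/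
theorem abs_termPi_le (hd : 2 ≤ P.d) {k j : ℕ} (hj : j ≤ P.m + P.K) (hjk : j ≤ k) {δ M δC MC : ℝ} (hδ : 0 < δ) (hδC : 0 < δC)
    (hM : 0 ≤ M) (hMC : 0 ≤ MC) (ρ : ℕ → ℝ)
    (hS : ∀ (b₀ : PBond P 0) (b₁ : PBond P j), |hlKerPi (P := P) ((P.eta k) ^ P.d) ((P.L : ℝ) ^ k) (ρ j / 16) (ρ j / 8) j b₀ b₁| ≤
      M * Real.exp (-(δ * distEU P j b₀.src b₁.src)))
    (hCl : ∀ b₁ b₂ : PBond P j, |Cloc P j (ρ j / 4) b₁ b₂| ≤ MC * Real.exp (-(δC * (supDist b₁.src b₂.src : ℝ))))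
    (b b'' : PBond P 0) :
    |termKerPi (P := P) ((P.eta k) ^ P.d) ((P.L : ℝ) ^ k) ρ j b b''| ≤
      M ^ 2 * (MC * ((P.L : ℝ) ^ (k - j)) ^ (P.d - 2)) * (P.d : ℝ) ^ 2 *
        (Real.exp (min δ δC / 2 / 2) * ((2 * (1 + P.d / (min δ δC / 2))) ^ P.d) ^ 2) *
        Real.exp (-(min δ δC / 2 * ((supDist b.src b''.src : ℝ) / (P.L : ℝ) ^ j))) := by
  have hMC' : 0 ≤ MC * ((P.L : ℝ) ^ (k - j)) ^ (P.d - 2) := mul_nonneg hMC (pow_pos (cast_pow_L_pos' _) _).le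
  rw [termKerPi_eq_sum]
  exact abs_triple_le hj hδ hδC hM hMC' hS (abs_clKer_ambient_le hd hjk hCl) b b''

/-- the scale-`j` term of the `η`-difference of the fork: `Σ_{b₁b₂}(H^Π_{j,loc}(⟨x+e_λ,μ⟩,b₁) − H^Π_{j,loc}(⟨x,μ⟩,b₁))·C^{(j)}_{loc}(b₁,b₂)·H^Π_{j,loc}(b″,b₂)`.
[cite: BalabanImbrieJaffe1988, (2.12) p.261] -/
theorem termKerPi_shift_sub_eq_sum (w c : ℝ) (ρ : ℕ → ℝ) (j : ℕ) (x : TSite P 0) (μ lam : Fin P.d) (b'' : PBond P 0) :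
    termKerPi (P := P) w c ρ j ⟨x.shift lam, μ⟩ b'' - termKerPi (P := P) w c ρ j ⟨x, μ⟩ b'' =
      ∑ b₁ : PBond P j, ∑ b₂ : PBond P j,
        (hlKerPi w c (ρ j / 16) (ρ j / 8) j ⟨x.shift lam, μ⟩ b₁ - hlKerPi w c (ρ j / 16) (ρ j / 8) j ⟨x, μ⟩ b₁) *
          clKer w c (ρ j / 4) j b₁ b₂ * hlKerPi w c (ρ j / 16) (ρ j / 8) j b'' b₂ := by
  unfold termKerPi
  rw [← Finset.sum_sub_distrib]
  refine Finset.sum_congr rfl fun b₁ _ => ?_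
  rw [← Finset.sum_sub_distrib]
  refine Finset.sum_congr rfl fun b₂ _ => ?_
  ring

/-- the scale-`j` term of the DOUBLE difference of the fork at two sites `x`, `x′`:
`Σ_{b₁b₂}((ΔH^Π_{j,loc})(⟨x,μ⟩,b₁) − (ΔH^Π_{j,loc})(⟨x′,μ⟩,b₁))·C^{(j)}_{loc}(b₁,b₂)·H^Π_{j,loc}(b″,b₂)`. [cite: BalabanImbrieJaffe1988, (2.12) p.261] -/
theorem termKerPi_secondDiff_eq_sum (w c : ℝ) (ρ : ℕ → ℝ) (j : ℕ) (x x' : TSite P 0) (μ lam : Fin P.d) (b'' : PBond P 0) :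
    (termKerPi (P := P) w c ρ j ⟨x.shift lam, μ⟩ b'' - termKerPi (P := P) w c ρ j ⟨x, μ⟩ b'') -
        (termKerPi (P := P) w c ρ j ⟨x'.shift lam, μ⟩ b'' - termKerPi (P := P) w c ρ j ⟨x', μ⟩ b'') =
      ∑ b₁ : PBond P j, ∑ b₂ : PBond P j,
        ((hlKerPi w c (ρ j / 16) (ρ j / 8) j ⟨x.shift lam, μ⟩ b₁ - hlKerPi w c (ρ j / 16) (ρ j / 8) j ⟨x, μ⟩ b₁) -
            (hlKerPi w c (ρ j / 16) (ρ j / 8) j ⟨x'.shift lam, μ⟩ b₁ - hlKerPi w c (ρ j / 16) (ρ j / 8) j ⟨x', μ⟩ b₁)) *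
          clKer w c (ρ j / 4) j b₁ b₂ * hlKerPi w c (ρ j / 16) (ρ j / 8) j b'' b₂ := by
  rw [termKerPi_shift_sub_eq_sum, termKerPi_shift_sub_eq_sum, ← Finset.sum_sub_distrib]
  refine Finset.sum_congr rfl fun b₁ _ => ?_
  rw [← Finset.sum_sub_distrib]
  refine Finset.sum_congr rfl fun b₂ _ => ?_
  ring

/-- **THE SCALE-`j` TERM OF THE `η`-DIFFERENCE OF THE FORK** (`j ≤ k`, `j ≤ m + K`, `d ≥ 2`): given the sup member `|H^Π_{j,loc}| ≤ Me^{−δ dist_j}`, the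
derivative member `‖λ ↦ L^j(H^Π_{j,loc}(⟨x+e_λ,μ⟩,b₁) − H^Π_{j,loc}(⟨x,μ⟩,b₁))‖ ≤ M₁e^{−δ dist_j(x,b₁)}` and the decay of `C^{(j)}_{loc}`, the term is at most
`L^{−j}·M₁M·M_C(L^{k−j})^{d−2}·d²e^{a/2}K(a)²·e^{−a|x−b″₋|_∞/L^j}` (p08's `abs_triple_le₂`). [cite: BalabanImbrieJaffe1988, (2.13) p.261] -/
theorem abs_gradTermPi_le (hd : 2 ≤ P.d) {k j : ℕ} (hj : j ≤ P.m + P.K) (hjk : j ≤ k) {δ M M₁ δC MC : ℝ} (hδ : 0 < δ) (hδC : 0 < δC)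
    (hM : 0 ≤ M) (hM₁ : 0 ≤ M₁) (hMC : 0 ≤ MC) (ρ : ℕ → ℝ)
    (hS : ∀ (b₀ : PBond P 0) (b₁ : PBond P j), |hlKerPi (P := P) ((P.eta k) ^ P.d) ((P.L : ℝ) ^ k) (ρ j / 16) (ρ j / 8) j b₀ b₁| ≤
      M * Real.exp (-(δ * distEU P j b₀.src b₁.src)))
    (hG : ∀ (μ : Fin P.d) (z : TSite P 0) (b₁ : PBond P j),
      ‖fun lam : Fin P.d => (P.L : ℝ) ^ j *
          (hlKerPi (P := P) ((P.eta k) ^ P.d) ((P.L : ℝ) ^ k) (ρ j / 16) (ρ j / 8) j ⟨z.shift lam, μ⟩ b₁ -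
            hlKerPi (P := P) ((P.eta k) ^ P.d) ((P.L : ℝ) ^ k) (ρ j / 16) (ρ j / 8) j ⟨z, μ⟩ b₁)‖ ≤
        M₁ * Real.exp (-(δ * distEU P j z b₁.src)))
    (hCl : ∀ b₁ b₂ : PBond P j, |Cloc P j (ρ j / 4) b₁ b₂| ≤ MC * Real.exp (-(δC * (supDist b₁.src b₂.src : ℝ))))
    (x : TSite P 0) (μ lam : Fin P.d) (b'' : PBond P 0) :
    |termKerPi (P := P) ((P.eta k) ^ P.d) ((P.L : ℝ) ^ k) ρ j ⟨x.shift lam, μ⟩ b'' -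
        termKerPi (P := P) ((P.eta k) ^ P.d) ((P.L : ℝ) ^ k) ρ j ⟨x, μ⟩ b''| ≤
      ((P.L : ℝ) ^ j)⁻¹ * M₁ * M * (MC * ((P.L : ℝ) ^ (k - j)) ^ (P.d - 2)) * (P.d : ℝ) ^ 2 *
        (Real.exp (min δ δC / 2 / 2) * ((2 * (1 + P.d / (min δ δC / 2))) ^ P.d) ^ 2) *
        Real.exp (-(min δ δC / 2 * ((supDist x b''.src : ℝ) / (P.L : ℝ) ^ j))) := by
  have hLj : 0 < (P.L : ℝ) ^ j := cast_pow_L_pos' j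
  have hMC' : 0 ≤ MC * ((P.L : ℝ) ^ (k - j)) ^ (P.d - 2) := mul_nonneg hMC (pow_pos (cast_pow_L_pos' _) _).le
  -- the difference kernel, componentwise from the pi-norm bound
  have hDiff : ∀ (b₀ : PBond P 0) (b₁ : PBond P j),
      |(fun (b₀ : PBond P 0) (b₁ : PBond P j) =>
          hlKerPi (P := P) ((P.eta k) ^ P.d) ((P.L : ℝ) ^ k) (ρ j / 16) (ρ j / 8) j ⟨b₀.src.shift lam, b₀.dir⟩ b₁ -
            hlKerPi (P := P) ((P.eta k) ^ P.d) ((P.L : ℝ) ^ k) (ρ j / 16) (ρ j / 8) j b₀ b₁) b₀ b₁| ≤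
        ((P.L : ℝ) ^ j)⁻¹ * M₁ * Real.exp (-(δ * distEU P j b₀.src b₁.src)) := by
    intro b₀ b₁
    have h1 := (norm_le_pi_norm (fun lam' : Fin P.d => (P.L : ℝ) ^ j *
      (hlKerPi (P := P) ((P.eta k) ^ P.d) ((P.L : ℝ) ^ k) (ρ j / 16) (ρ j / 8) j ⟨b₀.src.shift lam', b₀.dir⟩ b₁ -
        hlKerPi (P := P) ((P.eta k) ^ P.d) ((P.L : ℝ) ^ k) (ρ j / 16) (ρ j / 8) j ⟨b₀.src, b₀.dir⟩ b₁)) lam).trans (hG b₀.dir b₀.src b₁)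
    rw [Real.norm_eq_abs, abs_mul, abs_of_pos hLj] at h1
    rw [mul_assoc, le_inv_mul_iff₀ hLj]
    exact h1
  have h3 := abs_triple_le₂ hj hδ hδC (by positivity : 0 ≤ ((P.L : ℝ) ^ j)⁻¹ * M₁) hM hMC' hDiff hS
    (abs_clKer_ambient_le hd hjk hCl) ⟨x, μ⟩ b''
  rw [termKerPi_shift_sub_eq_sum]
  refine h3.trans (le_of_eq ?_)
  ring

/-- **THE SCALE-`j` TERM OF THE DOUBLE DIFFERENCE OF THE FORK** (`j ≤ k`, `j ≤ m + K`, `x ≠ x′`, `d ≥ 2`): with `r = |x − x′|_∞/L^j`, given the sup and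
derivative members for `H^Π_{j,loc}` (constant `M`), ITS ORDER-`(1+α)` HÖLDER MEMBER `r^{−α}‖λ ↦ ∇_λH^Π_{j,loc}(⟨x,μ⟩,b₁) − ∇_λH^Π_{j,loc}(⟨x′,μ⟩,b₁)‖ ≤
M_αe^{−δ dist_j(x,b₁)}` for `r ≤ 1` (gen 21's `holder25_hlKerPi…`) and the decay of `C^{(j)}_{loc}`, the term is at most
`L^{−j}·r^α·(M + M_α)M·M_C(L^{k−j})^{d−2}·d²e^{a/2}K(a)²·(e^{−a|x−b″₋|_∞/L^j} + e^{−a|x′−b″₋|_∞/L^j})`, `a = min(δ, δ_C)/2` (p08's `abs_holderTermDk_le` for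
the localized factors). [cite: BalabanImbrieJaffe1988, (2.13) p.261] -/
theorem abs_holderTermPi_le (hd : 2 ≤ P.d) {k j : ℕ} (hj : j ≤ P.m + P.K) (hjk : j ≤ k) {δ M Mα α δC MC : ℝ} (hδ : 0 < δ)
    (hδC : 0 < δC) (hM : 0 ≤ M) (hMα : 0 ≤ Mα) (hα : 0 ≤ α) (hMC : 0 ≤ MC) (ρ : ℕ → ℝ)
    (hS : ∀ (b₀ : PBond P 0) (b₁ : PBond P j), |hlKerPi (P := P) ((P.eta k) ^ P.d) ((P.L : ℝ) ^ k) (ρ j / 16) (ρ j / 8) j b₀ b₁| ≤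
      M * Real.exp (-(δ * distEU P j b₀.src b₁.src)))
    (hG : ∀ (μ : Fin P.d) (z : TSite P 0) (b₁ : PBond P j),
      ‖fun lam : Fin P.d => (P.L : ℝ) ^ j *
          (hlKerPi (P := P) ((P.eta k) ^ P.d) ((P.L : ℝ) ^ k) (ρ j / 16) (ρ j / 8) j ⟨z.shift lam, μ⟩ b₁ -
            hlKerPi (P := P) ((P.eta k) ^ P.d) ((P.L : ℝ) ^ k) (ρ j / 16) (ρ j / 8) j ⟨z, μ⟩ b₁)‖ ≤
        M * Real.exp (-(δ * distEU P j z b₁.src)))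
    (hHol : ∀ (μ : Fin P.d) (x x' : TSite P 0) (b₁ : PBond P j), x ≠ x' → (supDist x x' : ℝ) / (P.L : ℝ) ^ j ≤ 1 →
      ((supDist x x' : ℝ) / (P.L : ℝ) ^ j) ^ (-α) *
          ‖fun lam : Fin P.d =>
            (P.L : ℝ) ^ j * (hlKerPi (P := P) ((P.eta k) ^ P.d) ((P.L : ℝ) ^ k) (ρ j / 16) (ρ j / 8) j ⟨x.shift lam, μ⟩ b₁ -
                hlKerPi (P := P) ((P.eta k) ^ P.d) ((P.L : ℝ) ^ k) (ρ j / 16) (ρ j / 8) j ⟨x, μ⟩ b₁) -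
              (P.L : ℝ) ^ j * (hlKerPi (P := P) ((P.eta k) ^ P.d) ((P.L : ℝ) ^ k) (ρ j / 16) (ρ j / 8) j ⟨x'.shift lam, μ⟩ b₁ -
                hlKerPi (P := P) ((P.eta k) ^ P.d) ((P.L : ℝ) ^ k) (ρ j / 16) (ρ j / 8) j ⟨x', μ⟩ b₁)‖ ≤
        Mα * Real.exp (-(δ * distEU P j x b₁.src)))
    (hCl : ∀ b₁ b₂ : PBond P j, |Cloc P j (ρ j / 4) b₁ b₂| ≤ MC * Real.exp (-(δC * (supDist b₁.src b₂.src : ℝ))))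
    {x x' : TSite P 0} (hne : x ≠ x') (μ lam : Fin P.d) (b'' : PBond P 0) :
    |(termKerPi (P := P) ((P.eta k) ^ P.d) ((P.L : ℝ) ^ k) ρ j ⟨x.shift lam, μ⟩ b'' -
          termKerPi (P := P) ((P.eta k) ^ P.d) ((P.L : ℝ) ^ k) ρ j ⟨x, μ⟩ b'') -
        (termKerPi (P := P) ((P.eta k) ^ P.d) ((P.L : ℝ) ^ k) ρ j ⟨x'.shift lam, μ⟩ b'' -
          termKerPi (P := P) ((P.eta k) ^ P.d) ((P.L : ℝ) ^ k) ρ j ⟨x', μ⟩ b'')| ≤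
      ((P.L : ℝ) ^ j)⁻¹ * ((supDist x x' : ℝ) / (P.L : ℝ) ^ j) ^ α *
        ((M + Mα) * M * (MC * ((P.L : ℝ) ^ (k - j)) ^ (P.d - 2)) *
          ((P.d : ℝ) ^ 2 * (Real.exp (min δ δC / 2 / 2) * ((2 * (1 + P.d / (min δ δC / 2))) ^ P.d) ^ 2)) *
          (Real.exp (-(min δ δC / 2 * ((supDist x b''.src : ℝ) / (P.L : ℝ) ^ j))) +
            Real.exp (-(min δ δC / 2 * ((supDist x' b''.src : ℝ) / (P.L : ℝ) ^ j))))) := by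
  have hLj : 0 < (P.L : ℝ) ^ j := cast_pow_L_pos' j
  have hMC' : 0 ≤ MC * ((P.L : ℝ) ^ (k - j)) ^ (P.d - 2) := mul_nonneg hMC (pow_pos (cast_pow_L_pos' _) _).le
  set ρα : ℝ := ((supDist x x' : ℝ) / (P.L : ℝ) ^ j) ^ α with hρα
  have hρα0 : 0 ≤ ρα := Real.rpow_nonneg (div_nonneg (Nat.cast_nonneg _) hLj.le) α
  set H : PBond P 0 → PBond P j → ℝ := hlKerPi (P := P) ((P.eta k) ^ P.d) ((P.L : ℝ) ^ k) (ρ j / 16) (ρ j / 8) j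
  -- the double-difference kernel is bounded by two exponentials (§2 with `F = H(⟨·,μ⟩, b₁)`)
  have hE : ∀ b₁ : PBond P j,
      |(H ⟨x.shift lam, μ⟩ b₁ - H ⟨x, μ⟩ b₁) - (H ⟨x'.shift lam, μ⟩ b₁ - H ⟨x', μ⟩ b₁)| ≤
        ((P.L : ℝ) ^ j)⁻¹ * ρα * (M + Mα) *
          (Real.exp (-(δ * distEU P j x b₁.src)) + Real.exp (-(δ * distEU P j x' b₁.src))) := by
    intro b₁
    have h := abs_secondDiff_le_of_bounds (P := P) (j := j) hM hMα hα (F := fun z => H ⟨z, μ⟩ b₁)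
      (E := fun z => distEU P j z b₁.src) (fun z => hG μ z b₁) hne (fun hr => hHol μ x x' b₁ hne hr) lam
    rw [mul_assoc, mul_assoc, le_inv_mul_iff₀ hLj]
    refine h.trans (le_of_eq ?_)
    rw [hρα]
  have h3 := abs_triple_le_twoExp hj hδ hδC (by positivity : 0 ≤ ((P.L : ℝ) ^ j)⁻¹ * ρα * (M + Mα)) hM hMC'
    (E := fun b₁ => (H ⟨x.shift lam, μ⟩ b₁ - H ⟨x, μ⟩ b₁) - (H ⟨x'.shift lam, μ⟩ b₁ - H ⟨x', μ⟩ b₁))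
    (h' := H) (C := clKer (P := P) ((P.eta k) ^ P.d) ((P.L : ℝ) ^ k) (ρ j / 4) j) hE hS (abs_clKer_ambient_le hd hjk hCl) b''
  rw [termKerPi_secondDiff_eq_sum]
  refine h3.trans (le_of_eq ?_)
  ring

/-! ## §4  The multiscale sums: value, derivative and Hölder members of (2.13) for the fork, explicit constants -/

/-- the `η`-difference of the fork through its scale terms. [cite: BalabanImbrieJaffe1988, (2.12) p.261] -/
theorem dkLocKerPi_shift_sub_eq_sum (w c : ℝ) (ρ : ℕ → ℝ) (k : ℕ) (x : TSite P 0) (μ lam : Fin P.d) (b'' : PBond P 0) :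
    dkLocKerPi (P := P) w c ρ k ⟨x.shift lam, μ⟩ b'' - dkLocKerPi (P := P) w c ρ k ⟨x, μ⟩ b'' =
      ∑ j ∈ Finset.range k, (termKerPi (P := P) w c ρ j ⟨x.shift lam, μ⟩ b'' - termKerPi (P := P) w c ρ j ⟨x, μ⟩ b'') := by
  rw [dkLocKerPi_eq_sum, dkLocKerPi_eq_sum, ← Finset.sum_sub_distrib]

/-- the double difference of the fork through its scale terms. [cite: BalabanImbrieJaffe1988, (2.12) p.261] -/
theorem dkLocKerPi_secondDiff_eq_sum (w c : ℝ) (ρ : ℕ → ℝ) (k : ℕ) (x x' : TSite P 0) (μ lam : Fin P.d) (b'' : PBond P 0) :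
    (dkLocKerPi (P := P) w c ρ k ⟨x.shift lam, μ⟩ b'' - dkLocKerPi (P := P) w c ρ k ⟨x, μ⟩ b'') -
        (dkLocKerPi (P := P) w c ρ k ⟨x'.shift lam, μ⟩ b'' - dkLocKerPi (P := P) w c ρ k ⟨x', μ⟩ b'') =
      ∑ j ∈ Finset.range k, ((termKerPi (P := P) w c ρ j ⟨x.shift lam, μ⟩ b'' - termKerPi (P := P) w c ρ j ⟨x, μ⟩ b'') -
        (termKerPi (P := P) w c ρ j ⟨x'.shift lam, μ⟩ b'' - termKerPi (P := P) w c ρ j ⟨x', μ⟩ b'')) := by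
  rw [dkLocKerPi_shift_sub_eq_sum, dkLocKerPi_shift_sub_eq_sum, ← Finset.sum_sub_distrib]

/-- **EXPONENTIAL DECAY OF `𝒟^Π_{k,loc}(b, b″)`, explicit constants, every `d ≥ 2`, every schedule**: for `D := dist_k(b, b″) ≥ 2` and `a = min(δ, δ_C)/2`,
`|𝒟^Π_{k,loc}(b, b″)| ≤ M²M_C·d²e^{a/2}K(a)²·(d−1)!/a^{d−1}·e^{−(a/2)D}`, GIVEN the sup member for every `H^Π_{j,loc}` and the decay of every `C^{(j)}_{loc}`,
`j < k` — the value member of (2.13) for the fork (p08's `abs_dkLocKer_le` mechanism: scale term `≲ ℓ^{d−2}e^{−aℓD}`, `ℓ = L^{k−j}`).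
[cite: BalabanImbrieJaffe1988, (2.13) p.261] -/
theorem abs_dkLocKerPi_le (hd : 2 ≤ P.d) {k : ℕ} (hk : k ≤ P.m + P.K) {δ M δC MC : ℝ} (hδ : 0 < δ) (hδC : 0 < δC) (hM : 0 ≤ M)
    (hMC : 0 ≤ MC) (ρ : ℕ → ℝ)
    (hS : ∀ j < k, ∀ (b₀ : PBond P 0) (b₁ : PBond P j),
      |hlKerPi (P := P) ((P.eta k) ^ P.d) ((P.L : ℝ) ^ k) (ρ j / 16) (ρ j / 8) j b₀ b₁| ≤ M * Real.exp (-(δ * distEU P j b₀.src b₁.src)))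
    (hCl : ∀ j < k, ∀ b₁ b₂ : PBond P j, |Cloc P j (ρ j / 4) b₁ b₂| ≤ MC * Real.exp (-(δC * (supDist b₁.src b₂.src : ℝ))))
    {b b'' : PBond P 0} (hD : 2 ≤ kdist (P := P) k b b'') :
    |dkLocKerPi (P := P) ((P.eta k) ^ P.d) ((P.L : ℝ) ^ k) ρ k b b''| ≤
      M ^ 2 * MC * ((P.d : ℝ) ^ 2 * (Real.exp (min δ δC / 2 / 2) * ((2 * (1 + P.d / (min δ δC / 2))) ^ P.d) ^ 2)) *
        (((P.d - 2 + 1).factorial : ℝ) / (min δ δC / 2) ^ (P.d - 2 + 1)) * Real.exp (-(min δ δC / 2 / 2 * kdist (P := P) k b b'')) := by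
  have ha₀ : 0 < min δ δC / 2 := half_pos (lt_min hδ hδC)
  rw [dkLocKerPi_eq_sum]
  refine (abs_sum_scales_le (P := P) (k := k) (T := fun j => termKerPi (P := P) ((P.eta k) ^ P.d) ((P.L : ℝ) ^ k) ρ j b b'')
    (A := M ^ 2 * MC * ((P.d : ℝ) ^ 2 * (Real.exp (min δ δC / 2 / 2) * ((2 * (1 + P.d / (min δ δC / 2))) ^ P.d) ^ 2)))
    (a := min δ δC / 2) (D := kdist (P := P) k b b'') (by positivity) ha₀ hD (P.d - 2) fun j hjk => ?_).trans (le_of_eq (by ring))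
  have hj : j ≤ P.m + P.K := by omega
  have hLj := cast_pow_L_pos' (P := P) j
  have hLkj := cast_pow_L_pos' (P := P) (k - j)
  have e1 : (supDist b.src b''.src : ℝ) / (P.L : ℝ) ^ j = (P.L : ℝ) ^ (k - j) * kdist (P := P) k b b'' := by
    unfold kdist
    show (supDist b.src b''.src : ℝ) / (P.L : ℝ) ^ j = (P.L : ℝ) ^ (k - j) * ((supDist b.src b''.src : ℝ) / (P.L : ℝ) ^ k)
    rw [pow_eq_pow_mul_pow' (P := P) hjk.le]
    field_simp
  refine (abs_termPi_le hd hj hjk.le hδ hδC hM hMC ρ (hS j hjk) (hCl j hjk) b b'').trans (le_of_eq ?_)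
  rw [e1]; ring

/-- **EXPONENTIAL DECAY OF THE `η`-DERIVATIVE OF `𝒟^Π_{k,loc}(·, b″)`, explicit constants, every `d ≥ 2`**: for `D := dist_k(⟨x,μ⟩, b″) ≥ 2` and
`a = min(δ, δ_C)/2`, `|𝒟^Π_{k,loc}(⟨x+e_λ,μ⟩, b″) − 𝒟^Π_{k,loc}(⟨x,μ⟩, b″)| ≤ L^{−k}·M₁M·M_C·d²e^{a/2}K(a)²·d!/a^d·e^{−(a/2)D}` — the `η`-lattice derivative
(`η⁻¹ = L^k`) of the fork decays with constants UNIFORM IN `k` and in the schedule, GIVEN the sup and derivative members for every `H^Π_{j,loc}` and the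
decay of every `C^{(j)}_{loc}` (p08's `abs_dkLocKer_shift_sub_le` mechanism). [cite: BalabanImbrieJaffe1988, (2.13) p.261] -/
theorem abs_dkLocKerPi_shift_sub_le (hd : 2 ≤ P.d) {k : ℕ} (hk : k ≤ P.m + P.K) {δ M M₁ δC MC : ℝ} (hδ : 0 < δ) (hδC : 0 < δC)
    (hM : 0 ≤ M) (hM₁ : 0 ≤ M₁) (hMC : 0 ≤ MC) (ρ : ℕ → ℝ)
    (hS : ∀ j < k, ∀ (b₀ : PBond P 0) (b₁ : PBond P j),
      |hlKerPi (P := P) ((P.eta k) ^ P.d) ((P.L : ℝ) ^ k) (ρ j / 16) (ρ j / 8) j b₀ b₁| ≤ M * Real.exp (-(δ * distEU P j b₀.src b₁.src)))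
    (hG : ∀ j < k, ∀ (μ : Fin P.d) (z : TSite P 0) (b₁ : PBond P j),
      ‖fun lam : Fin P.d => (P.L : ℝ) ^ j *
          (hlKerPi (P := P) ((P.eta k) ^ P.d) ((P.L : ℝ) ^ k) (ρ j / 16) (ρ j / 8) j ⟨z.shift lam, μ⟩ b₁ -
            hlKerPi (P := P) ((P.eta k) ^ P.d) ((P.L : ℝ) ^ k) (ρ j / 16) (ρ j / 8) j ⟨z, μ⟩ b₁)‖ ≤
        M₁ * Real.exp (-(δ * distEU P j z b₁.src)))
    (hCl : ∀ j < k, ∀ b₁ b₂ : PBond P j, |Cloc P j (ρ j / 4) b₁ b₂| ≤ MC * Real.exp (-(δC * (supDist b₁.src b₂.src : ℝ))))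
    {x : TSite P 0} {μ : Fin P.d} (lam : Fin P.d) {b'' : PBond P 0} (hD : 2 ≤ kdist (P := P) k ⟨x, μ⟩ b'') :
    |dkLocKerPi (P := P) ((P.eta k) ^ P.d) ((P.L : ℝ) ^ k) ρ k ⟨x.shift lam, μ⟩ b'' -
        dkLocKerPi (P := P) ((P.eta k) ^ P.d) ((P.L : ℝ) ^ k) ρ k ⟨x, μ⟩ b''| ≤
      ((P.L : ℝ) ^ k)⁻¹ * (M₁ * M * MC * ((P.d : ℝ) ^ 2 *
          (Real.exp (min δ δC / 2 / 2) * ((2 * (1 + P.d / (min δ δC / 2))) ^ P.d) ^ 2))) *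
        (((P.d - 1 + 1).factorial : ℝ) / (min δ δC / 2) ^ (P.d - 1 + 1)) *
        Real.exp (-(min δ δC / 2 / 2 * kdist (P := P) k ⟨x, μ⟩ b'')) := by
  have ha₀ : 0 < min δ δC / 2 := half_pos (lt_min hδ hδC)
  have hLk : 0 < (P.L : ℝ) ^ k := cast_pow_L_pos' k
  rw [dkLocKerPi_shift_sub_eq_sum]
  have h := abs_sum_scales_le (P := P) (k := k)
    (T := fun j => termKerPi (P := P) ((P.eta k) ^ P.d) ((P.L : ℝ) ^ k) ρ j ⟨x.shift lam, μ⟩ b'' -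
      termKerPi (P := P) ((P.eta k) ^ P.d) ((P.L : ℝ) ^ k) ρ j ⟨x, μ⟩ b'')
    (A := ((P.L : ℝ) ^ k)⁻¹ * (M₁ * M * MC * ((P.d : ℝ) ^ 2 *
      (Real.exp (min δ δC / 2 / 2) * ((2 * (1 + P.d / (min δ δC / 2))) ^ P.d) ^ 2))))
    (a := min δ δC / 2) (D := kdist (P := P) k ⟨x, μ⟩ b'') (by positivity) ha₀ hD (P.d - 1) fun j hjk => ?_
  · refine h.trans (le_of_eq ?_)
    ring
  have hj : j ≤ P.m + P.K := by omega
  have hLj := cast_pow_L_pos' (P := P) j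
  have hLkj := cast_pow_L_pos' (P := P) (k - j)
  have e1 : (supDist x b''.src : ℝ) / (P.L : ℝ) ^ j = (P.L : ℝ) ^ (k - j) * kdist (P := P) k ⟨x, μ⟩ b'' := by
    unfold kdist
    show (supDist x b''.src : ℝ) / (P.L : ℝ) ^ j = (P.L : ℝ) ^ (k - j) * ((supDist x b''.src : ℝ) / (P.L : ℝ) ^ k)
    rw [pow_eq_pow_mul_pow' (P := P) hjk.le]
    field_simp
  have hpow : ((P.L : ℝ) ^ j)⁻¹ * ((P.L : ℝ) ^ (k - j)) ^ (P.d - 2) = ((P.L : ℝ) ^ k)⁻¹ * ((P.L : ℝ) ^ (k - j)) ^ (P.d - 1) := by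
    have hq : P.d - 1 = P.d - 2 + 1 := by omega
    rw [hq, pow_succ, pow_eq_pow_mul_pow' (P := P) hjk.le, mul_inv]
    field_simp
  refine (abs_gradTermPi_le hd hj hjk.le hδ hδC hM hM₁ hMC ρ (hS j hjk) (hG j hjk) (hCl j hjk) x μ lam b'').trans (le_of_eq ?_)
  rw [e1]
  calc ((P.L : ℝ) ^ j)⁻¹ * M₁ * M * (MC * ((P.L : ℝ) ^ (k - j)) ^ (P.d - 2)) * (P.d : ℝ) ^ 2 *
        (Real.exp (min δ δC / 2 / 2) * ((2 * (1 + P.d / (min δ δC / 2))) ^ P.d) ^ 2) *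
        Real.exp (-(min δ δC / 2 * ((P.L : ℝ) ^ (k - j) * kdist (P := P) k ⟨x, μ⟩ b'')))
      = (((P.L : ℝ) ^ j)⁻¹ * ((P.L : ℝ) ^ (k - j)) ^ (P.d - 2)) * (M₁ * M * MC * (P.d : ℝ) ^ 2 *
        (Real.exp (min δ δC / 2 / 2) * ((2 * (1 + P.d / (min δ δC / 2))) ^ P.d) ^ 2) *
        Real.exp (-(min δ δC / 2 * ((P.L : ℝ) ^ (k - j) * kdist (P := P) k ⟨x, μ⟩ b'')))) := by ring
    _ = _ := by rw [hpow]; ring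

/-- **THE SCALE-`j` TERM OF THE DOUBLE DIFFERENCE AGAINST THE SCALING FACTORS** (`j < k ≤ m + K`): for `x ≠ x′` with `r := |x − x′|_∞/L^k ≤ 1` and
`D := dist_k(⟨x,μ⟩, b″)` (any), the scale-`j` term is at most `[L^{−k}r^α·2(M + M_α)MM_C·d²e^{a/2}K(a)²]·ℓ^d·e^{−aℓ(D−1)}` (`ℓ = L^{k−j}`, `a = min(δ,δ_C)/2`):
in §3's bound `L^{−j}(ℓr)^α(ℓ)^{d−2} ≤ L^{−k}r^αℓ^d` (`ℓ^α ≤ ℓ` for `α ≤ 1 ≤ ℓ`) and both exponentials are `≤ e^{−aℓ(D−1)}` (`|x′ − b″₋|_∞/L^k ≥ D − 1`)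
— p08's `abs_holderTermDk_scaled_le` for the localized factors. [cite: BalabanImbrieJaffe1988, (2.13) p.261] -/
theorem abs_holderTermPi_scaled_le (hd : 2 ≤ P.d) {k j : ℕ} (hjk : j < k) (hj : j ≤ P.m + P.K) {δ M Mα α δC MC : ℝ} (hδ : 0 < δ)
    (hδC : 0 < δC) (hM : 0 ≤ M) (hMα : 0 ≤ Mα) (hα : 0 ≤ α) (hα1 : α ≤ 1) (hMC : 0 ≤ MC) (ρ : ℕ → ℝ)
    (hS : ∀ (b₀ : PBond P 0) (b₁ : PBond P j), |hlKerPi (P := P) ((P.eta k) ^ P.d) ((P.L : ℝ) ^ k) (ρ j / 16) (ρ j / 8) j b₀ b₁| ≤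
      M * Real.exp (-(δ * distEU P j b₀.src b₁.src)))
    (hG : ∀ (μ : Fin P.d) (z : TSite P 0) (b₁ : PBond P j),
      ‖fun lam : Fin P.d => (P.L : ℝ) ^ j *
          (hlKerPi (P := P) ((P.eta k) ^ P.d) ((P.L : ℝ) ^ k) (ρ j / 16) (ρ j / 8) j ⟨z.shift lam, μ⟩ b₁ -
            hlKerPi (P := P) ((P.eta k) ^ P.d) ((P.L : ℝ) ^ k) (ρ j / 16) (ρ j / 8) j ⟨z, μ⟩ b₁)‖ ≤
        M * Real.exp (-(δ * distEU P j z b₁.src)))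
    (hHol : ∀ (μ : Fin P.d) (x x' : TSite P 0) (b₁ : PBond P j), x ≠ x' → (supDist x x' : ℝ) / (P.L : ℝ) ^ j ≤ 1 →
      ((supDist x x' : ℝ) / (P.L : ℝ) ^ j) ^ (-α) *
          ‖fun lam : Fin P.d =>
            (P.L : ℝ) ^ j * (hlKerPi (P := P) ((P.eta k) ^ P.d) ((P.L : ℝ) ^ k) (ρ j / 16) (ρ j / 8) j ⟨x.shift lam, μ⟩ b₁ -
                hlKerPi (P := P) ((P.eta k) ^ P.d) ((P.L : ℝ) ^ k) (ρ j / 16) (ρ j / 8) j ⟨x, μ⟩ b₁) -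
              (P.L : ℝ) ^ j * (hlKerPi (P := P) ((P.eta k) ^ P.d) ((P.L : ℝ) ^ k) (ρ j / 16) (ρ j / 8) j ⟨x'.shift lam, μ⟩ b₁ -
                hlKerPi (P := P) ((P.eta k) ^ P.d) ((P.L : ℝ) ^ k) (ρ j / 16) (ρ j / 8) j ⟨x', μ⟩ b₁)‖ ≤
        Mα * Real.exp (-(δ * distEU P j x b₁.src)))
    (hCl : ∀ b₁ b₂ : PBond P j, |Cloc P j (ρ j / 4) b₁ b₂| ≤ MC * Real.exp (-(δC * (supDist b₁.src b₂.src : ℝ))))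
    {x x' : TSite P 0} (hne : x ≠ x') (hr : (supDist x x' : ℝ) / (P.L : ℝ) ^ k ≤ 1) (μ lam : Fin P.d) (b'' : PBond P 0) :
    |(termKerPi (P := P) ((P.eta k) ^ P.d) ((P.L : ℝ) ^ k) ρ j ⟨x.shift lam, μ⟩ b'' -
          termKerPi (P := P) ((P.eta k) ^ P.d) ((P.L : ℝ) ^ k) ρ j ⟨x, μ⟩ b'') -
        (termKerPi (P := P) ((P.eta k) ^ P.d) ((P.L : ℝ) ^ k) ρ j ⟨x'.shift lam, μ⟩ b'' -
          termKerPi (P := P) ((P.eta k) ^ P.d) ((P.L : ℝ) ^ k) ρ j ⟨x', μ⟩ b'')| ≤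
      ((P.L : ℝ) ^ k)⁻¹ * ((supDist x x' : ℝ) / (P.L : ℝ) ^ k) ^ α *
          (2 * ((M + Mα) * M * MC) * ((P.d : ℝ) ^ 2 * (Real.exp (min δ δC / 2 / 2) * ((2 * (1 + P.d / (min δ δC / 2))) ^ P.d) ^ 2))) *
        ((P.L : ℝ) ^ (k - j)) ^ P.d * Real.exp (-(min δ δC / 2 * ((P.L : ℝ) ^ (k - j) * (kdist (P := P) k ⟨x, μ⟩ b'' - 1)))) := by
  set a₀ : ℝ := min δ δC / 2 with ha₀
  have ha₀p : 0 < a₀ := by rw [ha₀]; exact half_pos (lt_min hδ hδC)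
  have hLk : 0 < (P.L : ℝ) ^ k := cast_pow_L_pos' k
  set D : ℝ := kdist (P := P) k ⟨x, μ⟩ b''
  have hDeq : D = (supDist x b''.src : ℝ) / (P.L : ℝ) ^ k := rfl
  set rk : ℝ := (supDist x x' : ℝ) / (P.L : ℝ) ^ k with hrk
  have hrk0 : 0 ≤ rk := div_nonneg (Nat.cast_nonneg _) hLk.le
  set K : ℝ := (P.d : ℝ) ^ 2 * (Real.exp (a₀ / 2) * ((2 * (1 + P.d / a₀)) ^ P.d) ^ 2)
  -- `|x′ − b″₋| ≥ |x − b″₋| − |x − x′|`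
  have hD' : D - 1 ≤ (supDist x' b''.src : ℝ) / (P.L : ℝ) ^ k := by
    have ht : (supDist x b''.src : ℝ) ≤ (supDist x x' : ℝ) + (supDist x' b''.src : ℝ) := by
      exact_mod_cast supDist_triangle x x' b''.src
    have h1 : D ≤ rk + (supDist x' b''.src : ℝ) / (P.L : ℝ) ^ k := by
      rw [hDeq, hrk, ← add_div]
      exact div_le_div_of_nonneg_right ht hLk.le
    linarith
  refine (abs_holderTermPi_le hd hj hjk.le hδ hδC hM hMα hα hMC ρ hS hG hHol hCl hne μ lam b'').trans ?_
  set ℓ : ℝ := (P.L : ℝ) ^ (k - j) with hℓ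
  have hℓ1 : 1 ≤ ℓ := one_le_pow₀ (by exact_mod_cast P.L_pos)
  have hℓ0 : 0 < ℓ := by linarith
  have hscale : ∀ z : TSite P 0, (supDist z b''.src : ℝ) / (P.L : ℝ) ^ j = ℓ * ((supDist z b''.src : ℝ) / (P.L : ℝ) ^ k) := by
    intro z
    rw [pow_eq_pow_mul_pow' hjk.le, ← hℓ]
    field_simp
  have erj : (supDist x x' : ℝ) / (P.L : ℝ) ^ j = ℓ * rk := by
    rw [hrk, pow_eq_pow_mul_pow' hjk.le, ← hℓ]
    field_simp
  have hinv : ((P.L : ℝ) ^ j)⁻¹ = ((P.L : ℝ) ^ k)⁻¹ * ℓ := by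
    rw [pow_eq_pow_mul_pow' hjk.le, ← hℓ, mul_inv, mul_assoc, inv_mul_cancel₀ hℓ0.ne', mul_one]
  -- `(ℓr)^α ≤ ℓ·r^α`
  have hrj : (ℓ * rk) ^ α ≤ ℓ * rk ^ α := by
    rw [Real.mul_rpow hℓ0.le hrk0]
    refine mul_le_mul_of_nonneg_right ?_ (Real.rpow_nonneg hrk0 α)
    have h := Real.rpow_le_rpow_of_exponent_le hℓ1 hα1
    rwa [Real.rpow_one] at h
  -- both exponentials against `e^{−aℓ(D−1)}`
  set D' : ℝ := (supDist x' b''.src : ℝ) / (P.L : ℝ) ^ k with hD'def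
  have haℓ : 0 < a₀ * ℓ := mul_pos ha₀p hℓ0
  have hE : Real.exp (-(a₀ * (ℓ * D))) + Real.exp (-(a₀ * (ℓ * D'))) ≤ 2 * Real.exp (-(a₀ * (ℓ * (D - 1)))) := by
    have h1 : Real.exp (-(a₀ * (ℓ * D))) ≤ Real.exp (-(a₀ * (ℓ * (D - 1)))) :=
      Real.exp_le_exp.2 (by nlinarith)
    have h2 : Real.exp (-(a₀ * (ℓ * D'))) ≤ Real.exp (-(a₀ * (ℓ * (D - 1)))) :=
      Real.exp_le_exp.2 (by nlinarith)
    linarith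
  have hB0 : 0 ≤ (M + Mα) * M * (MC * ℓ ^ (P.d - 2)) * K := by positivity
  have hp : ℓ * ℓ * ℓ ^ (P.d - 2) = ℓ ^ P.d := by
    rw [← pow_two, ← pow_add]; congr 1; omega
  rw [hscale x, hscale x', erj, hinv, ← hDeq, ← hD'def]
  calc ((P.L : ℝ) ^ k)⁻¹ * ℓ * (ℓ * rk) ^ α * ((M + Mα) * M * (MC * ℓ ^ (P.d - 2)) * K *
        (Real.exp (-(a₀ * (ℓ * D))) + Real.exp (-(a₀ * (ℓ * D')))))
      ≤ ((P.L : ℝ) ^ k)⁻¹ * ℓ * (ℓ * rk ^ α) * ((M + Mα) * M * (MC * ℓ ^ (P.d - 2)) * K *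
        (2 * Real.exp (-(a₀ * (ℓ * (D - 1)))))) :=
        mul_le_mul (mul_le_mul_of_nonneg_left hrj (by positivity)) (mul_le_mul_of_nonneg_left hE hB0) (by positivity)
          (by positivity)
    _ = ((P.L : ℝ) ^ k)⁻¹ * rk ^ α * (2 * ((M + Mα) * M * MC) * K) *
        (ℓ * ℓ * ℓ ^ (P.d - 2)) * Real.exp (-(a₀ * (ℓ * (D - 1)))) := by ring
    _ = _ := by rw [hp]

/-- **EXPONENTIAL DECAY OF THE HÖLDER QUOTIENT OF `∇𝒟^Π_{k,loc}(·, b″)` ON THE TORI, explicit constants, every `d ≥ 2`**: for fine sites `x ≠ x′` with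
`r := |x − x′|_∞/L^k ≤ 1`, `D := dist_k(⟨x,μ⟩, b″) ≥ 3`, `0 ≤ α ≤ 1` and `a = min(δ, δ_C)/2`:
`|Δ_λ𝒟^Π_{k,loc}(⟨x,μ⟩, b″) − Δ_λ𝒟^Π_{k,loc}(⟨x′,μ⟩, b″)| ≤ L^{−k}·r^α·2(M + M_α)MM_C·d²e^{a/2}K(a)²·(d+1)!/a^{d+1}·e^{−(a/2)(D−1)}` — i.e. the Hölder quotient
`|x − x′|^{−α}|∇𝒟^Π_{k,loc}(x, b″) − ∇𝒟^Π_{k,loc}(x′, b″)|` (`∇ = η⁻¹Δ`, distances in the unit `L^kη`) decays exponentially, UNIFORMLY IN `k` AND IN THE SCHEDULE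
— GIVEN the sup, derivative and order-`(1+α)` Hölder members for every `H^Π_{j,loc}`, `j < k`, and the decay of every `C^{(j)}_{loc}`; the multiscale step
is p08's `abs_sum_scales_le` at `D − 1 ≥ 2` with exponent `d`. **This is the clause of (2.13) *"… and Hölder derivatives of order less than 2"* for the
smooth-cutoff fork.** [cite: BalabanImbrieJaffe1988, (2.13) p.261] -/
theorem abs_dkLocKerPi_secondDiff_le (hd : 2 ≤ P.d) {k : ℕ} (hk : k ≤ P.m + P.K) {δ M Mα α δC MC : ℝ} (hδ : 0 < δ) (hδC : 0 < δC)
    (hM : 0 ≤ M) (hMα : 0 ≤ Mα) (hα : 0 ≤ α) (hα1 : α ≤ 1) (hMC : 0 ≤ MC) (ρ : ℕ → ℝ)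
    (hS : ∀ j < k, ∀ (b₀ : PBond P 0) (b₁ : PBond P j),
      |hlKerPi (P := P) ((P.eta k) ^ P.d) ((P.L : ℝ) ^ k) (ρ j / 16) (ρ j / 8) j b₀ b₁| ≤ M * Real.exp (-(δ * distEU P j b₀.src b₁.src)))
    (hG : ∀ j < k, ∀ (μ : Fin P.d) (z : TSite P 0) (b₁ : PBond P j),
      ‖fun lam : Fin P.d => (P.L : ℝ) ^ j *
          (hlKerPi (P := P) ((P.eta k) ^ P.d) ((P.L : ℝ) ^ k) (ρ j / 16) (ρ j / 8) j ⟨z.shift lam, μ⟩ b₁ -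
            hlKerPi (P := P) ((P.eta k) ^ P.d) ((P.L : ℝ) ^ k) (ρ j / 16) (ρ j / 8) j ⟨z, μ⟩ b₁)‖ ≤
        M * Real.exp (-(δ * distEU P j z b₁.src)))
    (hHol : ∀ j < k, ∀ (μ : Fin P.d) (x x' : TSite P 0) (b₁ : PBond P j), x ≠ x' → (supDist x x' : ℝ) / (P.L : ℝ) ^ j ≤ 1 →
      ((supDist x x' : ℝ) / (P.L : ℝ) ^ j) ^ (-α) *
          ‖fun lam : Fin P.d =>
            (P.L : ℝ) ^ j * (hlKerPi (P := P) ((P.eta k) ^ P.d) ((P.L : ℝ) ^ k) (ρ j / 16) (ρ j / 8) j ⟨x.shift lam, μ⟩ b₁ -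
                hlKerPi (P := P) ((P.eta k) ^ P.d) ((P.L : ℝ) ^ k) (ρ j / 16) (ρ j / 8) j ⟨x, μ⟩ b₁) -
              (P.L : ℝ) ^ j * (hlKerPi (P := P) ((P.eta k) ^ P.d) ((P.L : ℝ) ^ k) (ρ j / 16) (ρ j / 8) j ⟨x'.shift lam, μ⟩ b₁ -
                hlKerPi (P := P) ((P.eta k) ^ P.d) ((P.L : ℝ) ^ k) (ρ j / 16) (ρ j / 8) j ⟨x', μ⟩ b₁)‖ ≤
        Mα * Real.exp (-(δ * distEU P j x b₁.src)))
    (hCl : ∀ j < k, ∀ b₁ b₂ : PBond P j, |Cloc P j (ρ j / 4) b₁ b₂| ≤ MC * Real.exp (-(δC * (supDist b₁.src b₂.src : ℝ))))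
    {x x' : TSite P 0} (hne : x ≠ x') (hr : (supDist x x' : ℝ) / (P.L : ℝ) ^ k ≤ 1) (μ lam : Fin P.d) {b'' : PBond P 0}
    (hD : 3 ≤ kdist (P := P) k ⟨x, μ⟩ b'') :
    |(dkLocKerPi (P := P) ((P.eta k) ^ P.d) ((P.L : ℝ) ^ k) ρ k ⟨x.shift lam, μ⟩ b'' -
          dkLocKerPi (P := P) ((P.eta k) ^ P.d) ((P.L : ℝ) ^ k) ρ k ⟨x, μ⟩ b'') -
        (dkLocKerPi (P := P) ((P.eta k) ^ P.d) ((P.L : ℝ) ^ k) ρ k ⟨x'.shift lam, μ⟩ b'' -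
          dkLocKerPi (P := P) ((P.eta k) ^ P.d) ((P.L : ℝ) ^ k) ρ k ⟨x', μ⟩ b'')| ≤
      ((P.L : ℝ) ^ k)⁻¹ * ((supDist x x' : ℝ) / (P.L : ℝ) ^ k) ^ α *
          (2 * ((M + Mα) * M * MC) * ((P.d : ℝ) ^ 2 * (Real.exp (min δ δC / 2 / 2) * ((2 * (1 + P.d / (min δ δC / 2))) ^ P.d) ^ 2))) *
        (((P.d + 1).factorial : ℝ) / (min δ δC / 2) ^ (P.d + 1)) *
        Real.exp (-(min δ δC / 2 / 2 * (kdist (P := P) k ⟨x, μ⟩ b'' - 1))) := by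
  have ha₀ : 0 < min δ δC / 2 := half_pos (lt_min hδ hδC)
  have hLk : 0 < (P.L : ℝ) ^ k := cast_pow_L_pos' k
  have hD2 : 2 ≤ kdist (P := P) k ⟨x, μ⟩ b'' - 1 := by linarith
  rw [dkLocKerPi_secondDiff_eq_sum]
  exact abs_sum_scales_le (P := P) (k := k)
    (T := fun j => (termKerPi (P := P) ((P.eta k) ^ P.d) ((P.L : ℝ) ^ k) ρ j ⟨x.shift lam, μ⟩ b'' -
        termKerPi (P := P) ((P.eta k) ^ P.d) ((P.L : ℝ) ^ k) ρ j ⟨x, μ⟩ b'') -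
      (termKerPi (P := P) ((P.eta k) ^ P.d) ((P.L : ℝ) ^ k) ρ j ⟨x'.shift lam, μ⟩ b'' -
        termKerPi (P := P) ((P.eta k) ^ P.d) ((P.L : ℝ) ^ k) ρ j ⟨x', μ⟩ b''))
    (A := ((P.L : ℝ) ^ k)⁻¹ * ((supDist x x' : ℝ) / (P.L : ℝ) ^ k) ^ α *
      (2 * ((M + Mα) * M * MC) * ((P.d : ℝ) ^ 2 * (Real.exp (min δ δC / 2 / 2) * ((2 * (1 + P.d / (min δ δC / 2))) ^ P.d) ^ 2))))
    (a := min δ δC / 2) (D := kdist (P := P) k ⟨x, μ⟩ b'' - 1)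
    (by positivity) ha₀ hD2 P.d fun j hjk =>
      abs_holderTermPi_scaled_le hd hjk (by omega) hδ hδC hM hMα hα hα1 hMC ρ (hS j hjk) (hG j hjk) (hHol j hjk) (hCl j hjk)
        hne hr μ lam b''

/-! ## §5  Over all tori, no hypothesis, one set of constants -/

section AllTori

/-- **THE THREE MEMBERS FOR `H^Π_{j,loc}` ON EVERY TORUS AND AT EVERY SCALE WITH ONE `(δ, M, M_α)`** (from `(d, L, α)` only): gen 21's
`exists_holderBounds_allTori` ((I.7.2.2) for p09's kernel family with *"constants independent of k, T_η"*, [6I] Prop. 1.2 over all tori inside)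
fed through the pointwise product rules `deriv25_zetaPi_of_bounds` / `holder25_zetaPi_of_bounds`, read in the (2.4) vocabulary `hlKerPi` (any
weights `w > 0`, `c ≠ 0`; radii admissible: `R₀ − R₁ ≥ 1`, `R₁L^j ≥ 1`, `R₀L^j ≤ (|T_η| − 3)/2`). [cite: BalabanImbrieJaffe1988, (2.5) p.260] -/
theorem exists_threeMembers_hlKerPi_allTori (d L : ℕ) {α : ℝ} (hα0 : 0 ≤ α) (hα1 : α < 1) :
    ∃ δ M Mα : ℝ, 0 < δ ∧ 0 ≤ M ∧ 0 ≤ Mα ∧ ∀ (P : Params) (_ : P.d = d) (_ : P.L = L) (j : ℕ) (_ : j ≤ P.m + P.K) (R₁ R₀ : ℝ),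
      1 ≤ R₀ - R₁ → 1 ≤ R₁ * (P.L : ℝ) ^ j → R₀ * (P.L : ℝ) ^ j ≤ ((P.sitesPerDir 0 : ℝ) - 3) / 2 → ∀ (w : ℝ), 0 < w → ∀ (c : ℝ), c ≠ 0 →
      (∀ (b₀ : PBond P 0) (b₁ : PBond P j), |hlKerPi (P := P) w c R₁ R₀ j b₀ b₁| ≤ M * Real.exp (-(δ * distEU P j b₀.src b₁.src))) ∧
      (∀ (μ : Fin P.d) (z : TSite P 0) (b₁ : PBond P j),
        ‖fun lam : Fin P.d => (P.L : ℝ) ^ j * (hlKerPi (P := P) w c R₁ R₀ j ⟨z.shift lam, μ⟩ b₁ - hlKerPi (P := P) w c R₁ R₀ j ⟨z, μ⟩ b₁)‖ ≤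
          M * Real.exp (-(δ * distEU P j z b₁.src))) ∧
      (∀ (μ : Fin P.d) (x x' : TSite P 0) (b₁ : PBond P j), x ≠ x' → (supDist x x' : ℝ) / (P.L : ℝ) ^ j ≤ 1 →
        ((supDist x x' : ℝ) / (P.L : ℝ) ^ j) ^ (-α) *
          ‖fun lam : Fin P.d =>
            (P.L : ℝ) ^ j * (hlKerPi (P := P) w c R₁ R₀ j ⟨x.shift lam, μ⟩ b₁ - hlKerPi (P := P) w c R₁ R₀ j ⟨x, μ⟩ b₁) -
            (P.L : ℝ) ^ j * (hlKerPi (P := P) w c R₁ R₀ j ⟨x'.shift lam, μ⟩ b₁ - hlKerPi (P := P) w c R₁ R₀ j ⟨x', μ⟩ b₁)‖ ≤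
          Mα * Real.exp (-(δ * distEU P j x b₁.src))) := by
  obtain ⟨C, hC0, hC1, hC2⟩ := exists_abs_deriv_and_deriv_deriv_smoothTransition_le
  obtain ⟨δ, M, hδ, hM, hall⟩ := exists_holderBounds_allTori d L one_pos hα0 hα1
  refine ⟨δ, (1 + C) * M, holderConst d M M C (C ^ 2 + C) δ, hδ, by positivity, holderConst_nonneg d hM hM hC0 (by positivity) δ,
    fun P hPd hPL j hj R₁ R₀ hw1 hR1 hR0 w hw c hc => ⟨fun b₀ b₁ => ?_, fun μ z b₁ => ?_, fun μ x x' b₁ hne hr => ?_⟩⟩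
  · -- sup: `|ζ^Π H| ≤ |H| ≤ Me^{−δ dist} ≤ (1 + C)Me^{−δ dist}`
    obtain ⟨hHB, -⟩ := hall P hPd hPL j hj b₀.dir b₁.dir b₁.src
    have h1 : |hKer (P := P) w c j b₀ b₁| ≤ M * Real.exp (-(δ * distEU P j b₀.src b₁.src)) := by
      rw [show b₀ = ⟨b₀.src, b₀.dir⟩ from rfl, hKer_eq_H hj hw hc one_pos]
      exact (le_add_of_nonneg_right (norm_nonneg _)).trans (hHB b₀.src)
    refine (abs_hlKerPi_le_abs w c R₁ R₀ j b₀ b₁).trans (h1.trans ?_)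
    have hex : 0 ≤ Real.exp (-(δ * distEU P j b₀.src b₁.src)) := (Real.exp_pos _).le
    nlinarith [mul_nonneg hC0 (mul_nonneg hM hex)]
  · -- derivative
    obtain ⟨hHB, -⟩ := hall P hPd hPL j hj μ b₁.dir b₁.src
    have hv : (fun lam : Fin P.d => (P.L : ℝ) ^ j * (hlKerPi (P := P) w c R₁ R₀ j ⟨z.shift lam, μ⟩ b₁ - hlKerPi (P := P) w c R₁ R₀ j ⟨z, μ⟩ b₁)) =
        fun lam : Fin P.d =>
          (P.L : ℝ) ^ j * (zetaPi R₁ R₀ j (z.shift lam) b₁.src * (torusRep P j (deltaAData hj 1)).H (z.shift lam, μ) (b₁.src, b₁.dir) -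
            zetaPi R₁ R₀ j z b₁.src * (torusRep P j (deltaAData hj 1)).H (z, μ) (b₁.src, b₁.dir)) :=
      funext fun lam => by simp only [hlKerPi_eq_H hj hw hc one_pos]
    rw [hv]
    exact deriv25_zetaPi_of_bounds hC0 hC1 hw1 (G := fun z' => (torusRep P j (deltaAData hj 1)).H (z', μ) (b₁.src, b₁.dir)) hHB z
  · -- Hölder
    obtain ⟨hHB, hHol⟩ := hall P hPd hPL j hj μ b₁.dir b₁.src
    have hv : (fun lam : Fin P.d =>
          (P.L : ℝ) ^ j * (hlKerPi (P := P) w c R₁ R₀ j ⟨x.shift lam, μ⟩ b₁ - hlKerPi (P := P) w c R₁ R₀ j ⟨x, μ⟩ b₁) -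
          (P.L : ℝ) ^ j * (hlKerPi (P := P) w c R₁ R₀ j ⟨x'.shift lam, μ⟩ b₁ - hlKerPi (P := P) w c R₁ R₀ j ⟨x', μ⟩ b₁)) =
        fun lam : Fin P.d =>
          (P.L : ℝ) ^ j * (zetaPi R₁ R₀ j (x.shift lam) b₁.src * (torusRep P j (deltaAData hj 1)).H (x.shift lam, μ) (b₁.src, b₁.dir) -
              zetaPi R₁ R₀ j x b₁.src * (torusRep P j (deltaAData hj 1)).H (x, μ) (b₁.src, b₁.dir)) -
          (P.L : ℝ) ^ j * (zetaPi R₁ R₀ j (x'.shift lam) b₁.src * (torusRep P j (deltaAData hj 1)).H (x'.shift lam, μ) (b₁.src, b₁.dir) -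
              zetaPi R₁ R₀ j x' b₁.src * (torusRep P j (deltaAData hj 1)).H (x', μ) (b₁.src, b₁.dir)) :=
      funext fun lam => by simp only [hlKerPi_eq_H hj hw hc one_pos]
    rw [hv]
    have h := holder25_zetaPi_of_bounds hC0 hC1 hC2 hδ.le hM hM hα1.le hw1 hR1 hR0
      (G := fun z => (torusRep P j (deltaAData hj 1)).H (z, μ) (b₁.src, b₁.dir)) hHB hne hr (hHol x x' hne hr)
    have e : holderConst P.d M M C (C ^ 2 + C) δ = holderConst d M M C (C ^ 2 + C) δ := by rw [hPd]
    rw [e] at h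
    exact h

/-- **THE HÖLDER CLAUSE OF (2.13) FOR THE SMOOTH-CUTOFF (2.12), HYPOTHESIS-FREE OVER ALL TORI, ONE SET OF CONSTANTS** (`2 ≤ d`): for every
`0 ≤ α < 1` there are `R₀`, `c₂ ≥ 0`, `δ′ > 0` (from `(d, L, α)` only) such that on EVERY torus `P` with `P.d = d`, `P.L = L`, for every step
`k ≤ m + K`, every radius schedule with `ρ_j ≥ 16` and `ρ_jL^j/4 + 3 ≤ |T_η|` (`j < k`), all fine sites `x ≠ x′` with `|x − x′|_∞/L^k ≤ 1`, all
`μ, λ` and all `η`-bonds `b″` with `dist_k(⟨x,μ⟩, b″) ≥ R₀`: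
`L^k·|Δ_λ𝒟^Π_{k,loc}(⟨x,μ⟩, b″) − Δ_λ𝒟^Π_{k,loc}(⟨x′,μ⟩, b″)| ≤ c₂·(|x − x′|_∞/L^k)^α·e^{−δ′dist_k(⟨x,μ⟩, b″)}` at the weights `(η_k^d, L^k)` of step `k`
— *"and similarly for … Hölder derivatives of order less than 2"*, with (I.7.2.2)'s *"constants independent of k, T_η"*; inputs BY NAME: §5's
three members for `H^Π_{j,loc}` (gen 21 / p19 / p09), p09 g8's `(d, L)`-only `cloc_decay` for the `C^{(j)}_{loc}` of record, §4.
[cite: BalabanImbrieJaffe1988, (2.13) p.261] -/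
theorem holderDkLocPi_allTori {d L : ℕ} (hd : 2 ≤ d) {α : ℝ} (hα0 : 0 ≤ α) (hα1 : α < 1) :
    ∃ R₀ c₂ δ' : ℝ, 0 < δ' ∧ 0 ≤ c₂ ∧ ∀ (P : Params) (_ : P.d = d) (_ : P.L = L) (k : ℕ) (_ : k ≤ P.m + P.K) (ρ : ℕ → ℝ)
      (_ : ∀ j < k, 16 ≤ ρ j) (_ : ∀ j < k, ρ j * (P.L : ℝ) ^ j / 4 + 3 ≤ (P.sitesPerDir 0 : ℝ))
      (x x' : TSite P 0) (_ : x ≠ x') (_ : (supDist x x' : ℝ) / (P.L : ℝ) ^ k ≤ 1) (μ lam : Fin P.d) (b'' : PBond P 0),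
      R₀ ≤ kdist (P := P) k ⟨x, μ⟩ b'' →
        (P.L : ℝ) ^ k * |(dkLocKerPi (P := P) ((P.eta k) ^ P.d) ((P.L : ℝ) ^ k) ρ k ⟨x.shift lam, μ⟩ b'' -
              dkLocKerPi (P := P) ((P.eta k) ^ P.d) ((P.L : ℝ) ^ k) ρ k ⟨x, μ⟩ b'') -
            (dkLocKerPi (P := P) ((P.eta k) ^ P.d) ((P.L : ℝ) ^ k) ρ k ⟨x'.shift lam, μ⟩ b'' -
              dkLocKerPi (P := P) ((P.eta k) ^ P.d) ((P.L : ℝ) ^ k) ρ k ⟨x', μ⟩ b'')| ≤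
          c₂ * ((supDist x x' : ℝ) / (P.L : ℝ) ^ k) ^ α * Real.exp (-δ' * kdist (P := P) k ⟨x, μ⟩ b'') := by
  obtain ⟨δ, M, Mα, hδ, hM, hMα, hall⟩ := exists_threeMembers_hlKerPi_allTori d L hα0 hα1
  obtain ⟨MC, δC, hMC, hδC, HC⟩ := cloc_decay d L hd
  have ha₀ : 0 < min δ δC / 2 := half_pos (lt_min hδ hδC)
  refine ⟨3, (2 * ((M + Mα) * M * MC) * ((d : ℝ) ^ 2 * (Real.exp (min δ δC / 2 / 2) * ((2 * (1 + d / (min δ δC / 2))) ^ d) ^ 2))) *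
      (((d + 1).factorial : ℝ) / (min δ δC / 2) ^ (d + 1)) * Real.exp (min δ δC / 2 / 2),
    min δ δC / 2 / 2, by positivity, by positivity,
    fun P hPd hPL k hk ρ hρ16 hρT x x' hne hr μ lam b'' hfar => ?_⟩
  have hw : 0 < (P.eta k) ^ P.d := pow_pos (eta_pos P k) _
  have hc : (P.L : ℝ) ^ k ≠ 0 := (pow_pos P.cast_L_pos k).ne'
  -- the radii of every scale `j < k` are admissible
  have hadm : ∀ j < k, 1 ≤ ρ j / 8 - ρ j / 16 ∧ 1 ≤ ρ j / 16 * (P.L : ℝ) ^ j ∧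
      ρ j / 8 * (P.L : ℝ) ^ j ≤ ((P.sitesPerDir 0 : ℝ) - 3) / 2 :=
    fun j hjk => printedRadii_admissible (P := P) j (hρ16 j hjk) (hρT j hjk)
  have hS : ∀ j < k, ∀ (b₀ : PBond P 0) (b₁ : PBond P j),
      |hlKerPi (P := P) ((P.eta k) ^ P.d) ((P.L : ℝ) ^ k) (ρ j / 16) (ρ j / 8) j b₀ b₁| ≤ M * Real.exp (-(δ * distEU P j b₀.src b₁.src)) :=
    fun j hjk => (hall P hPd hPL j (by omega) (ρ j / 16) (ρ j / 8) (hadm j hjk).1 (hadm j hjk).2.1 (hadm j hjk).2.2 _ hw _ hc).1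
  have hG : ∀ j < k, ∀ (μ : Fin P.d) (z : TSite P 0) (b₁ : PBond P j),
      ‖fun lam : Fin P.d => (P.L : ℝ) ^ j *
          (hlKerPi (P := P) ((P.eta k) ^ P.d) ((P.L : ℝ) ^ k) (ρ j / 16) (ρ j / 8) j ⟨z.shift lam, μ⟩ b₁ -
            hlKerPi (P := P) ((P.eta k) ^ P.d) ((P.L : ℝ) ^ k) (ρ j / 16) (ρ j / 8) j ⟨z, μ⟩ b₁)‖ ≤
        M * Real.exp (-(δ * distEU P j z b₁.src)) :=
    fun j hjk => (hall P hPd hPL j (by omega) (ρ j / 16) (ρ j / 8) (hadm j hjk).1 (hadm j hjk).2.1 (hadm j hjk).2.2 _ hw _ hc).2.1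
  have hHol : ∀ j < k, ∀ (μ : Fin P.d) (x x' : TSite P 0) (b₁ : PBond P j), x ≠ x' → (supDist x x' : ℝ) / (P.L : ℝ) ^ j ≤ 1 →
      ((supDist x x' : ℝ) / (P.L : ℝ) ^ j) ^ (-α) *
          ‖fun lam : Fin P.d =>
            (P.L : ℝ) ^ j * (hlKerPi (P := P) ((P.eta k) ^ P.d) ((P.L : ℝ) ^ k) (ρ j / 16) (ρ j / 8) j ⟨x.shift lam, μ⟩ b₁ -
                hlKerPi (P := P) ((P.eta k) ^ P.d) ((P.L : ℝ) ^ k) (ρ j / 16) (ρ j / 8) j ⟨x, μ⟩ b₁) -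
              (P.L : ℝ) ^ j * (hlKerPi (P := P) ((P.eta k) ^ P.d) ((P.L : ℝ) ^ k) (ρ j / 16) (ρ j / 8) j ⟨x'.shift lam, μ⟩ b₁ -
                hlKerPi (P := P) ((P.eta k) ^ P.d) ((P.L : ℝ) ^ k) (ρ j / 16) (ρ j / 8) j ⟨x', μ⟩ b₁)‖ ≤
        Mα * Real.exp (-(δ * distEU P j x b₁.src)) :=
    fun j hjk => (hall P hPd hPL j (by omega) (ρ j / 16) (ρ j / 8) (hadm j hjk).1 (hadm j hjk).2.1 (hadm j hjk).2.2 _ hw _ hc).2.2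
  have hCl : ∀ j < k, ∀ b₁ b₂ : PBond P j,
      |Cloc P j (ρ j / 4) b₁ b₂| ≤ MC * Real.exp (-(δC * (supDist b₁.src b₂.src : ℝ))) := by
    intro j hjk b₁ b₂
    have h := HC P hPd hPL j inferInstance (by omega) (ρ j / 4) b₁ b₂
    rwa [distB_apply] at h
  subst hPd
  have hLk : 0 < (P.L : ℝ) ^ k := pow_pos P.cast_L_pos k
  have h := abs_dkLocKerPi_secondDiff_le hd hk hδ hδC hM hMα hα0 hα1.le hMC.le ρ hS hG hHol hCl hne hr μ lam hfar
  -- `e^{−(a/2)(D−1)} = e^{a/2}e^{−(a/2)D}`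
  have hexp : Real.exp (-(min δ δC / 2 / 2 * (kdist (P := P) k ⟨x, μ⟩ b'' - 1))) =
      Real.exp (min δ δC / 2 / 2) * Real.exp (-(min δ δC / 2 / 2) * kdist (P := P) k ⟨x, μ⟩ b'') := by
    rw [← Real.exp_add]; congr 1; ring
  rw [hexp] at h
  calc _ ≤ (P.L : ℝ) ^ k * (((P.L : ℝ) ^ k)⁻¹ * ((supDist x x' : ℝ) / (P.L : ℝ) ^ k) ^ α *
          (2 * ((M + Mα) * M * MC) * ((P.d : ℝ) ^ 2 * (Real.exp (min δ δC / 2 / 2) * ((2 * (1 + P.d / (min δ δC / 2))) ^ P.d) ^ 2))) *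
          (((P.d + 1).factorial : ℝ) / (min δ δC / 2) ^ (P.d + 1)) *
          (Real.exp (min δ δC / 2 / 2) * Real.exp (-(min δ δC / 2 / 2) * kdist (P := P) k ⟨x, μ⟩ b''))) :=
        mul_le_mul_of_nonneg_left h hLk.le
    _ = _ := by rw [mul_inv_cancel_assoc₄ hLk.ne']; ring

/-- **THE DERIVATIVE MEMBER OF (2.13) FOR THE FORK, HYPOTHESIS-FREE OVER ALL TORI, ONE SET OF CONSTANTS** (`2 ≤ d`; schedules with `ρ_j ≥ 16`,
`ρ_jL^j/4 + 3 ≤ |T_η|`): `L^k·|𝒟^Π_{k,loc}(⟨x+e_λ,μ⟩, b″) − 𝒟^Π_{k,loc}(⟨x,μ⟩, b″)| ≤ c₁e^{−δ′dist_k}` beyond `R₀` — *"similarly for derivatives of 𝒟_{k,loc}"*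
(p08's `gradDkLoc_allTori_of_prop12Printed` for the smooth cutoff, now without the Prop. 1.2 binder). [cite: BalabanImbrieJaffe1988, (2.13) p.261] -/
theorem gradDkLocPi_allTori {d L : ℕ} (hd : 2 ≤ d) :
    ∃ R₀ c₁ δ' : ℝ, 0 < δ' ∧ 0 ≤ c₁ ∧ ∀ (P : Params) (_ : P.d = d) (_ : P.L = L) (k : ℕ) (_ : k ≤ P.m + P.K) (ρ : ℕ → ℝ)
      (_ : ∀ j < k, 16 ≤ ρ j) (_ : ∀ j < k, ρ j * (P.L : ℝ) ^ j / 4 + 3 ≤ (P.sitesPerDir 0 : ℝ))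
      (x : TSite P 0) (μ lam : Fin P.d) (b'' : PBond P 0), R₀ ≤ kdist (P := P) k ⟨x, μ⟩ b'' →
        (P.L : ℝ) ^ k * |dkLocKerPi (P := P) ((P.eta k) ^ P.d) ((P.L : ℝ) ^ k) ρ k ⟨x.shift lam, μ⟩ b'' -
            dkLocKerPi (P := P) ((P.eta k) ^ P.d) ((P.L : ℝ) ^ k) ρ k ⟨x, μ⟩ b''| ≤
          c₁ * Real.exp (-δ' * kdist (P := P) k ⟨x, μ⟩ b'') := by
  obtain ⟨δ, M, Mα, hδ, hM, -, hall⟩ := exists_threeMembers_hlKerPi_allTori d L le_rfl zero_lt_one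
  obtain ⟨MC, δC, hMC, hδC, HC⟩ := cloc_decay d L hd
  have ha₀ : 0 < min δ δC / 2 := half_pos (lt_min hδ hδC)
  refine ⟨2, (M * M * MC * ((d : ℝ) ^ 2 * (Real.exp (min δ δC / 2 / 2) * ((2 * (1 + d / (min δ δC / 2))) ^ d) ^ 2))) *
      (((d - 1 + 1).factorial : ℝ) / (min δ δC / 2) ^ (d - 1 + 1)),
    min δ δC / 2 / 2, by positivity, by positivity, fun P hPd hPL k hk ρ hρ16 hρT x μ lam b'' hfar => ?_⟩
  have hw : 0 < (P.eta k) ^ P.d := pow_pos (eta_pos P k) _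
  have hc : (P.L : ℝ) ^ k ≠ 0 := (pow_pos P.cast_L_pos k).ne'
  have hadm : ∀ j < k, 1 ≤ ρ j / 8 - ρ j / 16 ∧ 1 ≤ ρ j / 16 * (P.L : ℝ) ^ j ∧
      ρ j / 8 * (P.L : ℝ) ^ j ≤ ((P.sitesPerDir 0 : ℝ) - 3) / 2 :=
    fun j hjk => printedRadii_admissible (P := P) j (hρ16 j hjk) (hρT j hjk)
  have hS : ∀ j < k, ∀ (b₀ : PBond P 0) (b₁ : PBond P j),
      |hlKerPi (P := P) ((P.eta k) ^ P.d) ((P.L : ℝ) ^ k) (ρ j / 16) (ρ j / 8) j b₀ b₁| ≤ M * Real.exp (-(δ * distEU P j b₀.src b₁.src)) :=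
    fun j hjk => (hall P hPd hPL j (by omega) (ρ j / 16) (ρ j / 8) (hadm j hjk).1 (hadm j hjk).2.1 (hadm j hjk).2.2 _ hw _ hc).1
  have hG : ∀ j < k, ∀ (μ : Fin P.d) (z : TSite P 0) (b₁ : PBond P j),
      ‖fun lam : Fin P.d => (P.L : ℝ) ^ j *
          (hlKerPi (P := P) ((P.eta k) ^ P.d) ((P.L : ℝ) ^ k) (ρ j / 16) (ρ j / 8) j ⟨z.shift lam, μ⟩ b₁ -
            hlKerPi (P := P) ((P.eta k) ^ P.d) ((P.L : ℝ) ^ k) (ρ j / 16) (ρ j / 8) j ⟨z, μ⟩ b₁)‖ ≤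
        M * Real.exp (-(δ * distEU P j z b₁.src)) :=
    fun j hjk => (hall P hPd hPL j (by omega) (ρ j / 16) (ρ j / 8) (hadm j hjk).1 (hadm j hjk).2.1 (hadm j hjk).2.2 _ hw _ hc).2.1
  have hCl : ∀ j < k, ∀ b₁ b₂ : PBond P j,
      |Cloc P j (ρ j / 4) b₁ b₂| ≤ MC * Real.exp (-(δC * (supDist b₁.src b₂.src : ℝ))) := by
    intro j hjk b₁ b₂
    have h := HC P hPd hPL j inferInstance (by omega) (ρ j / 4) b₁ b₂
    rwa [distB_apply] at h
  subst hPd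
  have hLk : 0 < (P.L : ℝ) ^ k := pow_pos P.cast_L_pos k
  have h := abs_dkLocKerPi_shift_sub_le hd hk hδ hδC hM hM hMC.le ρ hS hG hCl lam hfar
  rw [neg_mul]
  calc _ ≤ (P.L : ℝ) ^ k * (((P.L : ℝ) ^ k)⁻¹ * (M * M * MC * ((P.d : ℝ) ^ 2 *
          (Real.exp (min δ δC / 2 / 2) * ((2 * (1 + P.d / (min δ δC / 2))) ^ P.d) ^ 2))) *
          (((P.d - 1 + 1).factorial : ℝ) / (min δ δC / 2) ^ (P.d - 1 + 1)) *
          Real.exp (-(min δ δC / 2 / 2 * kdist (P := P) k ⟨x, μ⟩ b''))) := mul_le_mul_of_nonneg_left h hLk.le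
    _ = _ := by rw [mul_inv_cancel_assoc₃ hLk.ne']

/-- **THE VALUE MEMBER OF (2.13) FOR THE FORK, HYPOTHESIS-FREE OVER ALL TORI, ONE SET OF CONSTANTS** (`2 ≤ d`; schedules with `ρ_j ≥ 16`,
`ρ_jL^j/4 + 3 ≤ |T_η|`): `|𝒟^Π_{k,loc}(b, b″)| ≤ c₀e^{−δ′dist_k(b,b″)}` beyond `R₀` — the kernel form of *"|(𝒟_{k,loc}f)(b)| ≦ ce^{−c dist(supp f,b)}‖f‖_∞
(2.13)"* for the smooth cutoff. [cite: BalabanImbrieJaffe1988, (2.13) p.261] -/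
theorem decayDkLocPi_allTori {d L : ℕ} (hd : 2 ≤ d) :
    ∃ R₀ c₀ δ' : ℝ, 0 < δ' ∧ 0 ≤ c₀ ∧ ∀ (P : Params) (_ : P.d = d) (_ : P.L = L) (k : ℕ) (_ : k ≤ P.m + P.K) (ρ : ℕ → ℝ)
      (_ : ∀ j < k, 16 ≤ ρ j) (_ : ∀ j < k, ρ j * (P.L : ℝ) ^ j / 4 + 3 ≤ (P.sitesPerDir 0 : ℝ))
      (b b'' : PBond P 0), R₀ ≤ kdist (P := P) k b b'' →
        |dkLocKerPi (P := P) ((P.eta k) ^ P.d) ((P.L : ℝ) ^ k) ρ k b b''| ≤ c₀ * Real.exp (-δ' * kdist (P := P) k b b'') := by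
  obtain ⟨δ, M, Mα, hδ, hM, -, hall⟩ := exists_threeMembers_hlKerPi_allTori d L le_rfl zero_lt_one
  obtain ⟨MC, δC, hMC, hδC, HC⟩ := cloc_decay d L hd
  have ha₀ : 0 < min δ δC / 2 := half_pos (lt_min hδ hδC)
  refine ⟨2, M ^ 2 * MC * ((d : ℝ) ^ 2 * (Real.exp (min δ δC / 2 / 2) * ((2 * (1 + d / (min δ δC / 2))) ^ d) ^ 2)) *
      (((d - 2 + 1).factorial : ℝ) / (min δ δC / 2) ^ (d - 2 + 1)),
    min δ δC / 2 / 2, by positivity, by positivity, fun P hPd hPL k hk ρ hρ16 hρT b b'' hfar => ?_⟩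
  have hw : 0 < (P.eta k) ^ P.d := pow_pos (eta_pos P k) _
  have hc : (P.L : ℝ) ^ k ≠ 0 := (pow_pos P.cast_L_pos k).ne'
  have hadm : ∀ j < k, 1 ≤ ρ j / 8 - ρ j / 16 ∧ 1 ≤ ρ j / 16 * (P.L : ℝ) ^ j ∧
      ρ j / 8 * (P.L : ℝ) ^ j ≤ ((P.sitesPerDir 0 : ℝ) - 3) / 2 :=
    fun j hjk => printedRadii_admissible (P := P) j (hρ16 j hjk) (hρT j hjk)
  have hS : ∀ j < k, ∀ (b₀ : PBond P 0) (b₁ : PBond P j),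
      |hlKerPi (P := P) ((P.eta k) ^ P.d) ((P.L : ℝ) ^ k) (ρ j / 16) (ρ j / 8) j b₀ b₁| ≤ M * Real.exp (-(δ * distEU P j b₀.src b₁.src)) :=
    fun j hjk => (hall P hPd hPL j (by omega) (ρ j / 16) (ρ j / 8) (hadm j hjk).1 (hadm j hjk).2.1 (hadm j hjk).2.2 _ hw _ hc).1
  have hCl : ∀ j < k, ∀ b₁ b₂ : PBond P j,
      |Cloc P j (ρ j / 4) b₁ b₂| ≤ MC * Real.exp (-(δC * (supDist b₁.src b₂.src : ℝ))) := by
    intro j hjk b₁ b₂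
    have h := HC P hPd hPL j inferInstance (by omega) (ρ j / 4) b₁ b₂
    rwa [distB_apply] at h
  subst hPd
  have h := abs_dkLocKerPi_le hd hk hδ hδC hM hMC.le ρ hS hCl hfar
  rw [neg_mul]
  exact h

end AllTori

end

end Literature.MathematicalPhysics.QuantumFieldTheory.BalabanImbrieJaffe1984to88.BIJ88CurlyDkLocHolderTorus
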